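import Literature.NumberTheory.Rogawski1990.ArchHyperbolicOrbitHSBallThree     -- ★ (I1) `hs_inv_conj_le_iff`, `mat_apply_two_eq_mul_lift` (LH2-p03 (g3))
import Literature.NumberTheory.Rogawski1990.ArchUnitaryThreeHaarHSBall        -- ★ p849112 LH2-p01 (g3): brings `U21`∕ball∕chart∕Bergman imports, `mem_U21_iff_mem_unitaryGroupOfForm_J`, `GLn.conjEquiv`, `hs_unitary_conj`
import Literature.MeasureTheory.Group.QuotientMeasureSlabDescent             -- ★ p849188 LH2-p04 (g2): SLAB-DESCENT `quotientMeasure_setOf_descConj_le_le_inv_mul_measure`, `measure_setOf_chi_mem_Icc_ne_zero`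
import Literature.NumberTheory.Rogawski1990.ArchUnitaryThreeRegularHyperbolicClass  -- ★ p849262 LH2-p01 (g3): (Z″) `isClosed_coe_centralizer_singleton`, `chi_mul`, `chi_pos`, `continuous_chi`, `chi_onto`
import Literature.NumberTheory.Rogawski1990.ArchHyperbolicTorusShellThree          -- ★ p849237 LH2-p04 (g2): `measure_setOf_centralizer_normSq_mem_Icc_ne_top` (the `χ`-shell is compact ⇒ `hκ`)
import HarnessLib

/-!
# Harish-Chandra orbit-volume growth at the regular HYPERBOLIC classes of `U(2,1)`: `μ_{G⧸Z(γ)}{x̄ ∣ Σ|(xγx⁻¹)_{ij}|² ≤ R} ≤ C·R` — brick (H′-ball)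
# (Beuzart-Plessis 2020 §1.2, §1.8; Harish-Chandra 1966 §9; the ball model of Rudin 1980 §2.2)

Topic `NumberTheory/Rogawski1990`; namespace `Literature.NumberTheory.Rogawski1990`.  THEOREMS ONLY (no definition, no instance, no notation, no axiom, no named fact,
no `sorry`).  Cell `pub/hodgecm-mathlib`, crux H413 (`stmt-HodgeConjecture-24833`), F0∕P3c line LH2 (closer stub `stub_N8`, archimedean inner-form transfer; letters
O1″ [Shelstad1979 Thm. 4.1] ∕ O3″ [Bouaziz1994 Thm. 6.2.1 (i)] about `𝒞(G_∞) = ArchSchwartzOn L 3 Φ₃ 1`, `G_∞ ≅ U(2,1)^d`); seat LH2-p03 (g3), brick (H′-ball) (LH2-plan (g0) GO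
2026-09-02T04:28:48Z).  COUNT-NEUTRAL (VOL)-kit: restates no clause of (14.2.1), opens no vocabulary.

THE THEOREM (`quotientMeasure_hsOrbitBall_le_linear_of_diag_hyperbolic`).  `G = U(Φ₃)(ℂ) = unitaryGroupOfForm (starRingEnd ℂ) Φ₃` (`Φ₃ = antidiag(1,1,1)`, the cell's form),
`γ ∈ G` with matrix `diag(α, u, β)`, `α, u, β` pairwise distinct (the REGULAR HYPERBOLIC normal form: `|u| = 1`, `β = ᾱ⁻¹`, `|α| ≠ 1` — ★ `ArchUnitaryThreeRegularHyperbolicClass`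
(LH2-p01, (α‴)): every regular `γ ∈ G` with a non-unimodular eigenvalue is `G`-conjugate to one), `Z(γ)` its centraliser (the non-compact Cartan `{diag(a, b, ā⁻¹)} ≅ ℂˣ × S¹`),
`ν` a Haar measure on `G` (right- and inversion-invariant: `G` is unimodular), `ρ` a left-invariant, inversion-invariant measure on `Z(γ)` finite on compacts and positive on
opens (Haar), `μ = quotientMeasure Z(γ) ρ ν` the Weil quotient on `G ⧸ Z(γ)` (★ `quotientMeasure`).  THEN there is `C` with
  **`μ {x Z(γ) ∣ Σ_{ij} |(x γ x⁻¹)_{ij}|² ≤ R} ≤ C · R`  for all `R ≥ 1`**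
— LINEAR growth, the exponent `e = 1` of the Harish-Chandra Schwartz class of `U(2,1)` (★ `ArchSchwartzOn L 3 Φ₃ 1`): the `hplace` token of ★
`integrable_orbitalIntegrand_of_archSchwartzOn_of_placewise_growth` (p849184) at a HYPERBOLIC place, `a = 1`; UNCONDITIONAL — the torus tokens are consumed by
name: `χ(t) = |t₀₀|²` multiplicative ∕ positive ∕ continuous ∕ onto (★ `chi_mul`, `chi_pos`, `continuous_chi`, `chi_onto`, LH2-p01 (g3)) and the compact `χ`-shell
(★ `measure_setOf_centralizer_normSq_mem_Icc_ne_top`, LH2-p04 (g2)).  INFINITE-MEASURE CAVEAT: the `G`-Haar measure of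
`{g ∣ Σ|(g⁻¹γg)_{ij}|² ≤ R}` itself is `∞` (the set is left-`Z(γ)`-invariant and `Z(γ) ⊇ A` is not compact); the theorem is about the QUOTIENT measure, reached through a slab.

THE ROAD (no `KAK`, no Iwasawa coordinates on `U(2,1)`).
* §1 SYLVESTER TRANSPORT `e : G ≃ₜ* U21`, `e(g) = T g T⁻¹`, `T = 2^{-1∕2}(1,0,1; 0,√2,0; 1,0,−1)` real orthogonal, `Tᴴ J T = Φ₃` (`J = diag(1,1,−1)`, the ball-model form of
  ★ `Literature/Geometry/ComplexHyperbolic/UnitBallU21`; same datum as ★ `exists_unitary_formCongr_J_eq_antidiag_three`, whose witness is private there): HS-isometric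
  (★ `hs_unitary_conj`), and the last column of `e(g)` reads `(e g)₀₂ ± (e g)₂₂ = (g v)₀, (g v)₂` for the `Φ₃`-NEGATIVE vector `v = e₀ − e₂`.
* §2 THE TORUS AND THE SLAB ON `G`: every `t ∈ Z(γ)` is DIAGONAL with `|t₀₀|·|t₂₂| = 1` (for any regular diagonal `γ`); the slab function
  `s(g) = |(g v)₀| ∕ |(g v)₂|` is positive (negativity of `g v`), Borel, and `s(t g) = |t₀₀|² s(g)` — the binders `hsm`, `hspos`, `hseq` of ★ SLAB-DESCENT for `χ(t) = |t₀₀|²`.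
* §3 THE BALL PICTURE: under `e`, `{g ∣ HS²(g⁻¹γg) ≤ R, s(g) ∈ [1,2]}` is the orbit-map preimage of `D_R = {z ∈ 𝔹² ∣ 4|Σ \overline{ẑ_i} J_{ii} (TγT⁻¹)_{ij} ẑ_j|² ≤ (R+1)(1−|z|²)²,
  |z₀+1|∕|z₀−1| ∈ [1,2]}` (★ (I1) `hs_inv_conj_le_iff`), whose Haar mass is `c · β(D_R)` (★ `map_orbit_haar_eq_smul_bergmanVolume`).
* §4 THE BOX: in the hyperboloid chart `z = W∕√(1+|W|²)` (★ `bergmanVolume_eq_smul_map_chart`: `β = 9·chart_* vol`) the condition reads `|Φ(W)| ≤ √(R+1)∕2` with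
  `Φ(W) = −p(1+|W₁|²) + u|W₁|² − 2i q √(1+|W|²) Im W₀`, `p = (α+β)∕2`, `q = (α−β)∕2`; for `β = ᾱ⁻¹`: `|W₁|² ≤ K_m √(R+1)`, `(Im W₀)² ≤ K_b √(R+1)`, and the slab gives
  `0 ≤ Re W₀ ≤ (1 + 3|Im W₀| + |W₁|)∕2`; so `|W|² ≤ K √(R+1)` and `vol ≤ vol(B₁)·K²·(R+1)` (`dim_ℝ ℂ² = 4`) — LINEAR.
* §5 ASSEMBLY: ★ SLAB-DESCENT `quotientMeasure_setOf_descConj_le_le_inv_mul_measure` (`T := Z(γ)`, `F := Σ|·|²`, `l := 2`) ∘ §3 ∘ §4.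
HONEST LABEL: HC_CM is proved only modulo the 7 printed citations (2 remaining: hLiu418 = `stmt-HodgeConjecture-24832`, h413 = `stmt-HodgeConjecture-24833`) until rung 0
closes; this file is (VOL)-kit (count-neutral, +0∕+0): with (B′)(T3-out-G)(E′)(Z′)(α″)(Π′-G) it discharges ★ `ArchSchwartzOrbitalIntegralConvergenceTotalUnitary`'s placewise
hypothesis at the regular hyperbolic classes — the honest-integral certificate for the carrier of O1″∕O3″; it pays no printed row.

## References
* [BeuzartPlessis2020Asterisque] R. Beuzart-Plessis, *A local trace formula for the Gan–Gross–Prasad conjecture for unitary groups: the archimedean case*,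
  Astérisque 418 (2020), §1.2 (1.2.2), (1.2.4) p. 21 (orbit norms; Harish-Chandra's estimate), §1.8 p. 39 (convergence of Schwartz orbital integrals).
* [HarishChandra1966] Harish-Chandra, *Discrete series for semisimple Lie groups II*, Acta Math. 116 (1966), §9.
* [Rudin1980] W. Rudin, *Function Theory in the Unit Ball of ℂⁿ*, Grundlehren 241 (1980), §2.2 (Thm. 2.2.2, Thm. 2.2.6: automorphisms and the invariant measure).
* [Folland1995] G. B. Folland, *A Course in Abstract Harmonic Analysis* (1995), §2.6 Thm. 2.49 (Weil's formula on `G ⧸ H`).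
* [Rogawski1990] J. D. Rogawski, *Automorphic Representations of Unitary Groups in Three Variables*, Ann. of Math. Stud. 123 (1990), §3.6 p. 31 (Cartan subgroups of `U(2,1)`),
  §14.2 (14.2.1) p. 232 (the archimedean inner-form transfer).
-/

set_option autoImplicit false

noncomputable section

open MeasureTheory MeasureTheory.Measure Set Complex ComplexConjugate
open Literature.Geometry.ComplexHyperbolic Literature.Geometry.ComplexHyperbolic.BallModel
open Literature.AlgebraicGeometry.ShimuraVarieties.BallForms
open Literature.NumberTheory.Automorphic Literature.MeasureTheory.Group
open scoped ENNReal NNReal MatrixGroups Matrix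

namespace Literature.NumberTheory.Rogawski1990

/-! ## §1 The Sylvester transport `e : U(Φ₃)(ℂ) ≃ₜ* U21`, `e(g) = T g T⁻¹` -/

section Sylvester

/-- `Tᴴ T = 1` for the Sylvester matrix `T = 2^{-1∕2}(1,0,1; 0,√2,0; 1,0,−1)` (re-derivation of the private witness of ★ `exists_unitary_formCongr_J_eq_antidiag_three`). [folklore] -/
private theorem sylv_conjTranspose_mul_self : (!![((Real.sqrt 2)⁻¹ : ℂ), 0, ((Real.sqrt 2)⁻¹ : ℂ); 0, 1, 0; ((Real.sqrt 2)⁻¹ : ℂ), 0, -((Real.sqrt 2)⁻¹ : ℂ)] : Matrix (Fin 3) (Fin 3) ℂ)ᴴ * (!![((Real.sqrt 2)⁻¹ : ℂ), 0, ((Real.sqrt 2)⁻¹ : ℂ); 0, 1, 0; ((Real.sqrt 2)⁻¹ : ℂ), 0, -((Real.sqrt 2)⁻¹ : ℂ)] : Matrix (Fin 3) (Fin 3) ℂ) = 1 := by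
  have hsq : ((Real.sqrt 2 : ℝ) : ℂ) ^ 2 = 2 := by
    rw [← Complex.ofReal_pow, Real.sq_sqrt (by norm_num : (0 : ℝ) ≤ 2)]
    push_cast
    rfl
  have hstar : (starRingEnd ℂ) ((Real.sqrt 2)⁻¹ : ℂ) = ((Real.sqrt 2)⁻¹ : ℂ) := by
    rw [← Complex.ofReal_inv, Complex.conj_ofReal]
  ext i j
  fin_cases i <;> fin_cases j <;>
    simp [Matrix.conjTranspose, Matrix.mul_apply, Fin.sum_univ_three, hstar, ← pow_two, hsq] <;> norm_num

/-- `T T = 1`: the Sylvester matrix is a real symmetric involution, so `T⁻¹ = T`. [folklore] -/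
private theorem sylv_mul_self : (!![((Real.sqrt 2)⁻¹ : ℂ), 0, ((Real.sqrt 2)⁻¹ : ℂ); 0, 1, 0; ((Real.sqrt 2)⁻¹ : ℂ), 0, -((Real.sqrt 2)⁻¹ : ℂ)] : Matrix (Fin 3) (Fin 3) ℂ) * (!![((Real.sqrt 2)⁻¹ : ℂ), 0, ((Real.sqrt 2)⁻¹ : ℂ); 0, 1, 0; ((Real.sqrt 2)⁻¹ : ℂ), 0, -((Real.sqrt 2)⁻¹ : ℂ)] : Matrix (Fin 3) (Fin 3) ℂ) = 1 := by
  have hsq : ((Real.sqrt 2 : ℝ) : ℂ) ^ 2 = 2 := by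
    rw [← Complex.ofReal_pow, Real.sq_sqrt (by norm_num : (0 : ℝ) ≤ 2)]
    push_cast
    rfl
  ext i j
  fin_cases i <;> fin_cases j <;>
    simp [Matrix.mul_apply, Fin.sum_univ_three, ← pow_two, hsq] <;> norm_num

/-- `Tᴴ J T = Φ₃ = antidiag(1,1,1)`, `J = diag(1,1,−1)`. [folklore] -/
private theorem sylv_conjTranspose_mul_J_mul : (!![((Real.sqrt 2)⁻¹ : ℂ), 0, ((Real.sqrt 2)⁻¹ : ℂ); 0, 1, 0; ((Real.sqrt 2)⁻¹ : ℂ), 0, -((Real.sqrt 2)⁻¹ : ℂ)] : Matrix (Fin 3) (Fin 3) ℂ)ᴴ * J * (!![((Real.sqrt 2)⁻¹ : ℂ), 0, ((Real.sqrt 2)⁻¹ : ℂ); 0, 1, 0; ((Real.sqrt 2)⁻¹ : ℂ), 0, -((Real.sqrt 2)⁻¹ : ℂ)] : Matrix (Fin 3) (Fin 3) ℂ) = (Matrix.of fun i j : Fin 3 => if i.val + j.val + 1 = 3 then (1 : ℂ) else 0) := by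
  have hsq : ((Real.sqrt 2 : ℝ) : ℂ) ^ 2 = 2 := by
    rw [← Complex.ofReal_pow, Real.sq_sqrt (by norm_num : (0 : ℝ) ≤ 2)]
    push_cast
    rfl
  have hstar : (starRingEnd ℂ) ((Real.sqrt 2)⁻¹ : ℂ) = ((Real.sqrt 2)⁻¹ : ℂ) := by
    rw [← Complex.ofReal_inv, Complex.conj_ofReal]
  ext i j
  fin_cases i <;> fin_cases j <;>
    simp [Matrix.conjTranspose, Matrix.mul_apply, Fin.sum_univ_three, hstar, J, Matrix.diagonal, ← pow_two, hsq] <;> norm_num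

/-- The product of the two off-centre Sylvester entries: `(√2)⁻¹ · (√2)⁻¹ = 2⁻¹`. [folklore] -/
private theorem sqrt_two_inv_mul_self : ((Real.sqrt 2)⁻¹ : ℂ) * ((Real.sqrt 2)⁻¹ : ℂ) = 2⁻¹ := by
  have hsq : ((Real.sqrt 2 : ℝ) : ℂ) ^ 2 = 2 := by
    rw [← Complex.ofReal_pow, Real.sq_sqrt (by norm_num : (0 : ℝ) ≤ 2)]
    push_cast
    rfl
  rw [← pow_two, ← Complex.ofReal_inv, Complex.ofReal_inv, inv_pow, hsq]

/-- The last column of `T M T`: `(TMT)₀₂ + (TMT)₂₂ = M₀₀ − M₀₂` and `(TMT)₀₂ − (TMT)₂₂ = M₂₀ − M₂₂` — `T e₂ = (e₀ − e₂)∕√2` and the rows `0, 2` of `T` are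
`(e₀ ± e₂)∕√2`. [folklore] -/
private theorem sylv_conj_col_two (A : Matrix (Fin 3) (Fin 3) ℂ) :
    ((!![((Real.sqrt 2)⁻¹ : ℂ), 0, ((Real.sqrt 2)⁻¹ : ℂ); 0, 1, 0; ((Real.sqrt 2)⁻¹ : ℂ), 0, -((Real.sqrt 2)⁻¹ : ℂ)] : Matrix (Fin 3) (Fin 3) ℂ) * A * (!![((Real.sqrt 2)⁻¹ : ℂ), 0, ((Real.sqrt 2)⁻¹ : ℂ); 0, 1, 0; ((Real.sqrt 2)⁻¹ : ℂ), 0, -((Real.sqrt 2)⁻¹ : ℂ)] : Matrix (Fin 3) (Fin 3) ℂ)) 0 2 + ((!![((Real.sqrt 2)⁻¹ : ℂ), 0, ((Real.sqrt 2)⁻¹ : ℂ); 0, 1, 0; ((Real.sqrt 2)⁻¹ : ℂ), 0, -((Real.sqrt 2)⁻¹ : ℂ)] : Matrix (Fin 3) (Fin 3) ℂ) * A * (!![((Real.sqrt 2)⁻¹ : ℂ), 0, ((Real.sqrt 2)⁻¹ : ℂ); 0, 1, 0; ((Real.sqrt 2)⁻¹ : ℂ), 0, -((Real.sqrt 2)⁻¹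 : ℂ)] : Matrix (Fin 3) (Fin 3) ℂ)) 2 2 = A 0 0 - A 0 2 ∧
      ((!![((Real.sqrt 2)⁻¹ : ℂ), 0, ((Real.sqrt 2)⁻¹ : ℂ); 0, 1, 0; ((Real.sqrt 2)⁻¹ : ℂ), 0, -((Real.sqrt 2)⁻¹ : ℂ)] : Matrix (Fin 3) (Fin 3) ℂ) * A * (!![((Real.sqrt 2)⁻¹ : ℂ), 0, ((Real.sqrt 2)⁻¹ : ℂ); 0, 1, 0; ((Real.sqrt 2)⁻¹ : ℂ), 0, -((Real.sqrt 2)⁻¹ : ℂ)] : Matrix (Fin 3) (Fin 3) ℂ)) 0 2 - ((!![((Real.sqrt 2)⁻¹ : ℂ), 0, ((Real.sqrt 2)⁻¹ : ℂ); 0, 1, 0; ((Real.sqrt 2)⁻¹ : ℂ), 0, -((Real.sqrt 2)⁻¹ : ℂ)] : Matrix (Fin 3) (Fin 3) ℂ) * A * (!![((Real.sqrt 2)⁻¹ : ℂ), 0, ((Real.sqrt 2)⁻¹ : ℂ); 0, 1, 0; ((Real.sqrt 2)⁻¹ : ℂ), 0, -((Real.sqrt 2)⁻¹ : ℂ)]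 : Matrix (Fin 3) (Fin 3) ℂ)) 2 2 = A 2 0 - A 2 2 := by
  have h2 := sqrt_two_inv_mul_self
  refine ⟨?_, ?_⟩
  · simp only [Matrix.mul_apply, Fin.sum_univ_three, Matrix.of_apply, Matrix.cons_val', Matrix.cons_val_zero, Matrix.cons_val_one,
      Matrix.cons_val_two, Matrix.empty_val', Matrix.cons_val_fin_one, Matrix.head_cons, Matrix.head_fin_const, Matrix.tail_cons]
    linear_combination (2 * (A 0 0 - A 0 2)) * h2
  · simp only [Matrix.mul_apply, Fin.sum_univ_three, Matrix.of_apply, Matrix.cons_val', Matrix.cons_val_zero, Matrix.cons_val_one,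
      Matrix.cons_val_two, Matrix.empty_val', Matrix.cons_val_fin_one, Matrix.head_cons, Matrix.head_fin_const, Matrix.tail_cons]
    linear_combination (2 * (A 2 0 - A 2 2)) * h2

/-- Conjugation by the Sylvester involution preserves `Σ|·_{ij}|²` (`T` unitary, `T⁻¹ = T`; ★ `hs_unitary_conj`). [folklore] -/
private theorem hs_sylv_conj (A : Matrix (Fin 3) (Fin 3) ℂ) :
    ∑ i : Fin 3, ∑ j : Fin 3, ‖((!![((Real.sqrt 2)⁻¹ : ℂ), 0, ((Real.sqrt 2)⁻¹ : ℂ); 0, 1, 0; ((Real.sqrt 2)⁻¹ : ℂ), 0, -((Real.sqrt 2)⁻¹ : ℂ)] : Matrix (Fin 3) (Fin 3) ℂ) * A * (!![((Real.sqrt 2)⁻¹ : ℂ), 0, ((Real.sqrt 2)⁻¹ : ℂ); 0, 1, 0; ((Real.sqrt 2)⁻¹ : ℂ), 0, -((Real.sqrt 2)⁻¹ : ℂ)] : Matrix (Fin 3) (Fin 3) ℂ)) i j‖ ^ 2 = ∑ i : Fin 3, ∑ j : Fin 3, ‖A i j‖ ^ 2 := by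
  have h := hs_unitary_conj sylv_conjTranspose_mul_self A
  rwa [Matrix.inv_eq_left_inv sylv_mul_self] at h

/-- **THE SYLVESTER TRANSPORT `e : U(Φ₃)(ℂ) ≃ₜ* U21`, `e(g) = T g T`** (`T⁻¹ = T`): a bicontinuous group isomorphism onto the ball-model group (★ `GLn.conjEquiv`,
★ `ContinuousMulEquiv.restrictSubgroup`, ★ `mem_U21_iff_mem_unitaryGroupOfForm_J`) which preserves `Σ|·_{ij}|²` of conjugates and whose last column reads the
`Φ₃`-negative vector `g(e₀ − e₂)`: `(e g)₀₂ + (e g)₂₂ = g₀₀ − g₀₂`, `(e g)₀₂ − (e g)₂₂ = g₂₀ − g₂₂`. [cite: PlatonovRapinchuk1994, §2.3] [cite: Rudin1980, §2.2] -/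
theorem exists_sylvester_continuousMulEquiv_U21 :
    ∃ e : ↥(unitaryGroupOfForm (starRingEnd ℂ) (Matrix.of fun i j : Fin 3 => if i.val + j.val + 1 = 3 then (1 : ℂ) else 0)) ≃ₜ* ↥U21,
      (∀ g : ↥(unitaryGroupOfForm (starRingEnd ℂ) (Matrix.of fun i j : Fin 3 => if i.val + j.val + 1 = 3 then (1 : ℂ) else 0)), mat (e g) = (!![((Real.sqrt 2)⁻¹ : ℂ), 0, ((Real.sqrt 2)⁻¹ : ℂ); 0, 1, 0; ((Real.sqrt 2)⁻¹ : ℂ), 0, -((Real.sqrt 2)⁻¹ : ℂ)] : Matrix (Fin 3) (Fin 3) ℂ) * ((g : GL (Fin 3) ℂ) : Matrix (Fin 3) (Fin 3) ℂ) * (!![((Real.sqrt 2)⁻¹ : ℂ), 0, ((Real.sqrt 2)⁻¹ : ℂ); 0, 1, 0; ((Real.sqrt 2)⁻¹ : ℂ), 0, -((Real.sqrt 2)⁻¹ : ℂ)] : Matrix (Fin 3) (Fin 3) ℂ)) ∧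
      (∀ g x : ↥(unitaryGroupOfForm (starRingEnd ℂ) (Matrix.of fun i j : Fin 3 => if i.val + j.val + 1 = 3 then (1 : ℂ) else 0)), ∑ i : Fin 3, ∑ j : Fin 3, ‖mat ((e g)⁻¹ * e x * e g) i j‖ ^ 2 =
          ∑ i : Fin 3, ∑ j : Fin 3, ‖(((g⁻¹ * x * g : ↥(unitaryGroupOfForm (starRingEnd ℂ) (Matrix.of fun i j : Fin 3 => if i.val + j.val + 1 = 3 then (1 : ℂ) else 0))) : GL (Fin 3) ℂ) : Matrix (Fin 3) (Fin 3) ℂ) i j‖ ^ 2) ∧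
      (∀ g : ↥(unitaryGroupOfForm (starRingEnd ℂ) (Matrix.of fun i j : Fin 3 => if i.val + j.val + 1 = 3 then (1 : ℂ) else 0)), mat (e g) 0 2 + mat (e g) 2 2 = ((g : GL (Fin 3) ℂ) : Matrix (Fin 3) (Fin 3) ℂ) 0 0 - ((g : GL (Fin 3) ℂ) : Matrix (Fin 3) (Fin 3) ℂ) 0 2 ∧
          mat (e g) 0 2 - mat (e g) 2 2 = ((g : GL (Fin 3) ℂ) : Matrix (Fin 3) (Fin 3) ℂ) 2 0 - ((g : GL (Fin 3) ℂ) : Matrix (Fin 3) (Fin 3) ℂ) 2 2) := by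
  have hU := sylv_conjTranspose_mul_self
  have hunit : IsUnit (!![((Real.sqrt 2)⁻¹ : ℂ), 0, ((Real.sqrt 2)⁻¹ : ℂ); 0, 1, 0; ((Real.sqrt 2)⁻¹ : ℂ), 0, -((Real.sqrt 2)⁻¹ : ℂ)] : Matrix (Fin 3) (Fin 3) ℂ) := (Matrix.isUnit_iff_isUnit_det _).2 (Matrix.isUnit_det_of_left_inverse hU)
  set T : GL (Fin 3) ℂ := hunit.unit with hTdef
  have hTval : (T : Matrix (Fin 3) (Fin 3) ℂ) = (!![((Real.sqrt 2)⁻¹ : ℂ), 0, ((Real.sqrt 2)⁻¹ : ℂ); 0, 1, 0; ((Real.sqrt 2)⁻¹ : ℂ), 0, -((Real.sqrt 2)⁻¹ : ℂ)] : Matrix (Fin 3) (Fin 3) ℂ) := by rw [hTdef, IsUnit.unit_spec]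
  have hT : (T : Matrix (Fin 3) (Fin 3) ℂ)ᴴ * (T : Matrix (Fin 3) (Fin 3) ℂ) = 1 := by rw [hTval]; exact hU
  have hH : (T : Matrix (Fin 3) (Fin 3) ℂ)ᴴ * J * (T : Matrix (Fin 3) (Fin 3) ℂ) = (Matrix.of fun i j : Fin 3 => if i.val + j.val + 1 = 3 then (1 : ℂ) else 0) := by rw [hTval]; exact sylv_conjTranspose_mul_J_mul
  have hTinv : (T : Matrix (Fin 3) (Fin 3) ℂ)⁻¹ = (!![((Real.sqrt 2)⁻¹ : ℂ), 0, ((Real.sqrt 2)⁻¹ : ℂ); 0, 1, 0; ((Real.sqrt 2)⁻¹ : ℂ), 0, -((Real.sqrt 2)⁻¹ : ℂ)] : Matrix (Fin 3) (Fin 3) ℂ) := by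
    rw [hTval]
    exact Matrix.inv_eq_left_inv sylv_mul_self
  -- the conjugation isomorphism (★ p849112's construction)
  have hform : formCongr (starRingEnd ℂ) T J = (Matrix.of fun i j : Fin 3 => if i.val + j.val + 1 = 3 then (1 : ℂ) else 0) := by rw [formCongr_star, hH]
  have hmem : ∀ g : GL (Fin 3) ℂ, g ∈ unitaryGroupOfForm (starRingEnd ℂ) (Matrix.of fun i j : Fin 3 => if i.val + j.val + 1 = 3 then (1 : ℂ) else 0) ↔ GLn.conjEquiv T g ∈ U21 := fun g => by
    rw [GLn.conjEquiv_apply, mem_U21_iff_mem_unitaryGroupOfForm_J, conj_mem_unitaryGroupOfForm_iff, hform]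
  let e : ↥(unitaryGroupOfForm (starRingEnd ℂ) (Matrix.of fun i j : Fin 3 => if i.val + j.val + 1 = 3 then (1 : ℂ) else 0)) ≃ₜ* ↥U21 := ContinuousMulEquiv.restrictSubgroup (GLn.conjEquiv T) _ _ hmem
  have he : ∀ g : ↥(unitaryGroupOfForm (starRingEnd ℂ) (Matrix.of fun i j : Fin 3 => if i.val + j.val + 1 = 3 then (1 : ℂ) else 0)), mat (e g) = (!![((Real.sqrt 2)⁻¹ : ℂ), 0, ((Real.sqrt 2)⁻¹ : ℂ); 0, 1, 0; ((Real.sqrt 2)⁻¹ : ℂ), 0, -((Real.sqrt 2)⁻¹ : ℂ)] : Matrix (Fin 3) (Fin 3) ℂ) * ((g : GL (Fin 3) ℂ) : Matrix (Fin 3) (Fin 3) ℂ) * (!![((Real.sqrt 2)⁻¹ : ℂ), 0, ((Real.sqrt 2)⁻¹ : ℂ); 0, 1, 0; ((Real.sqrt 2)⁻¹ : ℂ), 0, -((Real.sqrt 2)⁻¹ : ℂ)] : Matrix (Fin 3) (Fin 3) ℂ) := fun g => by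
    show (((T * (g : GL (Fin 3) ℂ) * T⁻¹ : GL (Fin 3) ℂ)) : Matrix (Fin 3) (Fin 3) ℂ) = _
    rw [Units.val_mul, Units.val_mul, Matrix.coe_units_inv, hTinv, hTval]
  refine ⟨e, he, fun g x => ?_, fun g => ?_⟩
  · -- HS of conjugates is preserved (`e` is a hom, `T` is unitary, `T⁻¹ = T`)
    rw [← map_inv, ← map_mul, ← map_mul, he, hs_sylv_conj]
  · rw [he]
    exact sylv_conj_col_two _

end Sylvester

/-! ## §2 The torus `Z(γ)` of a regular diagonal `γ` and the slab function on `G = U(Φ₃)(ℂ)` -/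

section Torus

variable {α u β : ℂ} {γ : ↥(unitaryGroupOfForm (starRingEnd ℂ) (Matrix.of fun i j : Fin 3 => if i.val + j.val + 1 = 3 then (1 : ℂ) else 0))}

/-- **Every element of the centraliser of a regular diagonal `γ = diag(α, u, β)` (pairwise distinct entries) is DIAGONAL.** (`tγ = γt` entrywise:
`(γ_i − γ_j) t_{ij} = 0`.) [cite: Rogawski1990, §3.6 p. 31] -/
private theorem centralizer_apply_eq_zero_of_diag (hγ : ((γ : GL (Fin 3) ℂ) : Matrix (Fin 3) (Fin 3) ℂ) = !![α, 0, 0; 0, u, 0; 0, 0, β]) (hαu : α ≠ u) (huβ : u ≠ β) (hαβ : α ≠ β)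
    (t : ↥(Subgroup.centralizer ({γ} : Set ↥(unitaryGroupOfForm (starRingEnd ℂ) (Matrix.of fun i j : Fin 3 => if i.val + j.val + 1 = 3 then (1 : ℂ) else 0))))) :
    ((((t : ↥(Subgroup.centralizer ({γ} : Set ↥(unitaryGroupOfForm (starRingEnd ℂ) (Matrix.of fun i j : Fin 3 => if i.val + j.val + 1 = 3 then (1 : ℂ) else 0))))) : ↥(unitaryGroupOfForm (starRingEnd ℂ) (Matrix.of fun i j : Fin 3 => if i.val + j.val + 1 = 3 then (1 : ℂ) else 0))) : GL (Fin 3) ℂ) : Matrix (Fin 3) (Fin 3) ℂ) 0 1 = 0 ∧ ((((t : ↥(Subgroup.centralizer ({γ} : Set ↥(unitaryGroupOfForm (starRingEnd ℂ) (Matrix.of fun i j : Fin 3 => if i.val + j.val + 1 = 3 then (1 : ℂ) else 0))))) : ↥(unitaryGroupOfForm (starRingEnd ℂ) (Matrix.of fun i j : Fin 3 => if i.val + j.val + 1 = 3 then (1 : ℂ) else 0))) : GL (Fin 3) ℂ) : Matrix (Fin 3) (Fin 3) ℂ) 0 2 = 0 ∧ ((((t : ↥(Subgroup.centralizer ({γ}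 : Set ↥(unitaryGroupOfForm (starRingEnd ℂ) (Matrix.of fun i j : Fin 3 => if i.val + j.val + 1 = 3 then (1 : ℂ) else 0))))) : ↥(unitaryGroupOfForm (starRingEnd ℂ) (Matrix.of fun i j : Fin 3 => if i.val + j.val + 1 = 3 then (1 : ℂ) else 0))) : GL (Fin 3) ℂ) : Matrix (Fin 3) (Fin 3) ℂ) 1 0 = 0 ∧
      ((((t : ↥(Subgroup.centralizer ({γ} : Set ↥(unitaryGroupOfForm (starRingEnd ℂ) (Matrix.of fun i j : Fin 3 => if i.val + j.val + 1 = 3 then (1 : ℂ) else 0))))) : ↥(unitaryGroupOfForm (starRingEnd ℂ) (Matrix.of fun i j : Fin 3 => if i.val + j.val + 1 = 3 then (1 : ℂ) else 0))) : GL (Fin 3) ℂ) : Matrix (Fin 3) (Fin 3) ℂ) 1 2 = 0 ∧ ((((t : ↥(Subgroup.centralizer ({γ} : Set ↥(unitaryGroupOfForm (starRingEnd ℂ) (Matrix.of fun i j : Fin 3 => if i.val + j.val + 1 = 3 then (1 : ℂ) else 0))))) : ↥(unitaryGroupOfForm (starRingEnd ℂ) (Matrix.of fun i j : Fin 3 =>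 if i.val + j.val + 1 = 3 then (1 : ℂ) else 0))) : GL (Fin 3) ℂ) : Matrix (Fin 3) (Fin 3) ℂ) 2 0 = 0 ∧ ((((t : ↥(Subgroup.centralizer ({γ} : Set ↥(unitaryGroupOfForm (starRingEnd ℂ) (Matrix.of fun i j : Fin 3 => if i.val + j.val + 1 = 3 then (1 : ℂ) else 0))))) : ↥(unitaryGroupOfForm (starRingEnd ℂ) (Matrix.of fun i j : Fin 3 => if i.val + j.val + 1 = 3 then (1 : ℂ) else 0))) : GL (Fin 3) ℂ) : Matrix (Fin 3) (Fin 3) ℂ) 2 1 = 0 := by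
  have hc : γ * (t : ↥(unitaryGroupOfForm (starRingEnd ℂ) (Matrix.of fun i j : Fin 3 => if i.val + j.val + 1 = 3 then (1 : ℂ) else 0))) = (t : ↥(unitaryGroupOfForm (starRingEnd ℂ) (Matrix.of fun i j : Fin 3 => if i.val + j.val + 1 = 3 then (1 : ℂ) else 0))) * γ := (Subgroup.mem_centralizer_iff.1 t.2) γ (Set.mem_singleton γ)
  have hm := congrArg (fun y : ↥(unitaryGroupOfForm (starRingEnd ℂ) (Matrix.of fun i j : Fin 3 => if i.val + j.val + 1 = 3 then (1 : ℂ) else 0)) => ((y : GL (Fin 3) ℂ) : Matrix (Fin 3) (Fin 3) ℂ)) hc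
  simp only [Subgroup.coe_mul, Units.val_mul, hγ] at hm
  have e01 := congrArg (fun A => A 0 1) hm
  have e02 := congrArg (fun A => A 0 2) hm
  have e10 := congrArg (fun A => A 1 0) hm
  have e12 := congrArg (fun A => A 1 2) hm
  have e20 := congrArg (fun A => A 2 0) hm
  have e21 := congrArg (fun A => A 2 1) hm
  simp only [Matrix.mul_apply, Fin.sum_univ_three, Matrix.of_apply, Matrix.cons_val', Matrix.cons_val_zero, Matrix.cons_val_one,
    Matrix.cons_val_two, Matrix.empty_val', Matrix.cons_val_fin_one, Matrix.head_cons, Matrix.head_fin_const, Matrix.tail_cons,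
    zero_mul, mul_zero, add_zero, zero_add] at e01 e02 e10 e12 e20 e21
  refine ⟨?_, ?_, ?_, ?_, ?_, ?_⟩
  · have h : (α - u) * ((((t : ↥(Subgroup.centralizer ({γ} : Set ↥(unitaryGroupOfForm (starRingEnd ℂ) (Matrix.of fun i j : Fin 3 => if i.val + j.val + 1 = 3 then (1 : ℂ) else 0))))) : ↥(unitaryGroupOfForm (starRingEnd ℂ) (Matrix.of fun i j : Fin 3 => if i.val + j.val + 1 = 3 then (1 : ℂ) else 0))) : GL (Fin 3) ℂ) : Matrix (Fin 3) (Fin 3) ℂ) 0 1 = 0 := by linear_combination e01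
    exact (mul_eq_zero.1 h).resolve_left (sub_ne_zero.2 hαu)
  · have h : (α - β) * ((((t : ↥(Subgroup.centralizer ({γ} : Set ↥(unitaryGroupOfForm (starRingEnd ℂ) (Matrix.of fun i j : Fin 3 => if i.val + j.val + 1 = 3 then (1 : ℂ) else 0))))) : ↥(unitaryGroupOfForm (starRingEnd ℂ) (Matrix.of fun i j : Fin 3 => if i.val + j.val + 1 = 3 then (1 : ℂ) else 0))) : GL (Fin 3) ℂ) : Matrix (Fin 3) (Fin 3) ℂ) 0 2 = 0 := by linear_combination e02
    exact (mul_eq_zero.1 h).resolve_left (sub_ne_zero.2 hαβ)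
  · have h : (u - α) * ((((t : ↥(Subgroup.centralizer ({γ} : Set ↥(unitaryGroupOfForm (starRingEnd ℂ) (Matrix.of fun i j : Fin 3 => if i.val + j.val + 1 = 3 then (1 : ℂ) else 0))))) : ↥(unitaryGroupOfForm (starRingEnd ℂ) (Matrix.of fun i j : Fin 3 => if i.val + j.val + 1 = 3 then (1 : ℂ) else 0))) : GL (Fin 3) ℂ) : Matrix (Fin 3) (Fin 3) ℂ) 1 0 = 0 := by linear_combination e10
    exact (mul_eq_zero.1 h).resolve_left (sub_ne_zero.2 (Ne.symm hαu))
  · have h : (u - β) * ((((t : ↥(Subgroup.centralizer ({γ} : Set ↥(unitaryGroupOfForm (starRingEnd ℂ) (Matrix.of fun i j : Fin 3 => if i.val + j.val + 1 = 3 then (1 : ℂ) else 0))))) : ↥(unitaryGroupOfForm (starRingEnd ℂ) (Matrix.of fun i j : Fin 3 => if i.val + j.val + 1 = 3 then (1 : ℂ) else 0))) : GL (Fin 3) ℂ) : Matrix (Fin 3) (Fin 3) ℂ) 1 2 = 0 := by linear_combination e12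
    exact (mul_eq_zero.1 h).resolve_left (sub_ne_zero.2 huβ)
  · have h : (β - α) * ((((t : ↥(Subgroup.centralizer ({γ} : Set ↥(unitaryGroupOfForm (starRingEnd ℂ) (Matrix.of fun i j : Fin 3 => if i.val + j.val + 1 = 3 then (1 : ℂ) else 0))))) : ↥(unitaryGroupOfForm (starRingEnd ℂ) (Matrix.of fun i j : Fin 3 => if i.val + j.val + 1 = 3 then (1 : ℂ) else 0))) : GL (Fin 3) ℂ) : Matrix (Fin 3) (Fin 3) ℂ) 2 0 = 0 := by linear_combination e20
    exact (mul_eq_zero.1 h).resolve_left (sub_ne_zero.2 (Ne.symm hαβ))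
  · have h : (β - u) * ((((t : ↥(Subgroup.centralizer ({γ} : Set ↥(unitaryGroupOfForm (starRingEnd ℂ) (Matrix.of fun i j : Fin 3 => if i.val + j.val + 1 = 3 then (1 : ℂ) else 0))))) : ↥(unitaryGroupOfForm (starRingEnd ℂ) (Matrix.of fun i j : Fin 3 => if i.val + j.val + 1 = 3 then (1 : ℂ) else 0))) : GL (Fin 3) ℂ) : Matrix (Fin 3) (Fin 3) ℂ) 2 1 = 0 := by linear_combination e21
    exact (mul_eq_zero.1 h).resolve_left (sub_ne_zero.2 (Ne.symm huβ))

/-- **On the torus `|t₀₀| · |t₂₂| = 1`**: the `(0,2)` entry of `tᴴ Φ₃ t = Φ₃` for a diagonal `t` is `\overline{t₀₀} t₂₂ = 1` (so `Z(γ) = {diag(a, b, ā⁻¹)}`).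
[cite: Rogawski1990, §3.6 p. 31] -/
private theorem centralizer_norm_mul_norm_eq_one (hγ : ((γ : GL (Fin 3) ℂ) : Matrix (Fin 3) (Fin 3) ℂ) = !![α, 0, 0; 0, u, 0; 0, 0, β]) (hαu : α ≠ u) (huβ : u ≠ β) (hαβ : α ≠ β)
    (t : ↥(Subgroup.centralizer ({γ} : Set ↥(unitaryGroupOfForm (starRingEnd ℂ) (Matrix.of fun i j : Fin 3 => if i.val + j.val + 1 = 3 then (1 : ℂ) else 0))))) : ‖((((t : ↥(Subgroup.centralizer ({γ} : Set ↥(unitaryGroupOfForm (starRingEnd ℂ) (Matrix.of fun i j : Fin 3 => if i.val + j.val + 1 = 3 then (1 : ℂ) else 0))))) : ↥(unitaryGroupOfForm (starRingEnd ℂ) (Matrix.of fun i j : Fin 3 => if i.val + j.val + 1 = 3 then (1 : ℂ) else 0))) : GL (Fin 3) ℂ) : Matrix (Fin 3) (Fin 3) ℂ) 0 0‖ * ‖((((t : ↥(Subgroup.centralizer ({γ} : Set ↥(unitaryGroupOfForm (starRingEnd ℂ) (Matrix.of fun i j : Fin 3 => if i.val + j.val + 1 = 3 then (1 : ℂ)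 else 0))))) : ↥(unitaryGroupOfForm (starRingEnd ℂ) (Matrix.of fun i j : Fin 3 => if i.val + j.val + 1 = 3 then (1 : ℂ) else 0))) : GL (Fin 3) ℂ) : Matrix (Fin 3) (Fin 3) ℂ) 2 2‖ = 1 := by
  obtain ⟨h01, h02, h10, h12, h20, h21⟩ := centralizer_apply_eq_zero_of_diag hγ hαu huβ hαβ t
  have hmem := mem_unitaryGroupOfForm_iff.1 (t : ↥(unitaryGroupOfForm (starRingEnd ℂ) (Matrix.of fun i j : Fin 3 => if i.val + j.val + 1 = 3 then (1 : ℂ) else 0))).2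
  have e02 := congrArg (fun A => A 0 2) hmem
  simp only [Matrix.mul_apply, Fin.sum_univ_three, Matrix.transpose_apply, Matrix.map_apply, Matrix.of_apply, h02, h10, h12, h20,
    Fin.val_zero, Fin.val_one, Fin.val_two, Fin.isValue] at e02
  norm_num at e02
  have h := congrArg norm e02
  rw [norm_mul, RCLike.norm_conj, norm_one] at h
  exact h

/-- `|t₀₀| ≠ 0` on the torus. [cite: Rogawski1990, §3.6 p. 31] -/
private theorem centralizer_norm_apply_zero_ne_zero (hγ : ((γ : GL (Fin 3) ℂ) : Matrix (Fin 3) (Fin 3) ℂ) = !![α, 0, 0; 0, u, 0; 0, 0, β]) (hαu : α ≠ u) (huβ : u ≠ β) (hαβ : α ≠ β)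
    (t : ↥(Subgroup.centralizer ({γ} : Set ↥(unitaryGroupOfForm (starRingEnd ℂ) (Matrix.of fun i j : Fin 3 => if i.val + j.val + 1 = 3 then (1 : ℂ) else 0))))) : ‖((((t : ↥(Subgroup.centralizer ({γ} : Set ↥(unitaryGroupOfForm (starRingEnd ℂ) (Matrix.of fun i j : Fin 3 => if i.val + j.val + 1 = 3 then (1 : ℂ) else 0))))) : ↥(unitaryGroupOfForm (starRingEnd ℂ) (Matrix.of fun i j : Fin 3 => if i.val + j.val + 1 = 3 then (1 : ℂ) else 0))) : GL (Fin 3) ℂ) : Matrix (Fin 3) (Fin 3) ℂ) 0 0‖ ≠ 0 := by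
  intro h
  have h1 := centralizer_norm_mul_norm_eq_one hγ hαu huβ hαβ t
  rw [h, zero_mul] at h1
  exact zero_ne_one h1

/-- Rows `0` and `2` of a product `t g`, `t` in the torus: `(t g)_{0j} = t₀₀ g_{0j}`, `(t g)_{2j} = t₂₂ g_{2j}`. [cite: Rogawski1990, §3.6 p. 31] -/
private theorem centralizer_mul_apply (hγ : ((γ : GL (Fin 3) ℂ) : Matrix (Fin 3) (Fin 3) ℂ) = !![α, 0, 0; 0, u, 0; 0, 0, β]) (hαu : α ≠ u) (huβ : u ≠ β) (hαβ : α ≠ β)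
    (t : ↥(Subgroup.centralizer ({γ} : Set ↥(unitaryGroupOfForm (starRingEnd ℂ) (Matrix.of fun i j : Fin 3 => if i.val + j.val + 1 = 3 then (1 : ℂ) else 0))))) (g : ↥(unitaryGroupOfForm (starRingEnd ℂ) (Matrix.of fun i j : Fin 3 => if i.val + j.val + 1 = 3 then (1 : ℂ) else 0))) (j : Fin 3) :
    ((((t : ↥(unitaryGroupOfForm (starRingEnd ℂ) (Matrix.of fun i j : Fin 3 => if i.val + j.val + 1 = 3 then (1 : ℂ) else 0))) * g : ↥(unitaryGroupOfForm (starRingEnd ℂ) (Matrix.of fun i j : Fin 3 => if i.val + j.val + 1 = 3 then (1 : ℂ) else 0))) : GL (Fin 3) ℂ) : Matrix (Fin 3) (Fin 3) ℂ) 0 j = ((((t : ↥(Subgroup.centralizer ({γ} : Set ↥(unitaryGroupOfForm (starRingEnd ℂ) (Matrix.of fun i j : Fin 3 => if i.val + j.val + 1 = 3 then (1 : ℂ) else 0))))) : ↥(unitaryGroupOfForm (starRingEnd ℂ) (Matrix.of fun i j : Fin 3 => if i.val + j.val + 1 = 3 then (1 : ℂ) else 0))) : GL (Fin 3) ℂ)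 : Matrix (Fin 3) (Fin 3) ℂ) 0 0 * ((g : GL (Fin 3) ℂ) : Matrix (Fin 3) (Fin 3) ℂ) 0 j ∧
      ((((t : ↥(unitaryGroupOfForm (starRingEnd ℂ) (Matrix.of fun i j : Fin 3 => if i.val + j.val + 1 = 3 then (1 : ℂ) else 0))) * g : ↥(unitaryGroupOfForm (starRingEnd ℂ) (Matrix.of fun i j : Fin 3 => if i.val + j.val + 1 = 3 then (1 : ℂ) else 0))) : GL (Fin 3) ℂ) : Matrix (Fin 3) (Fin 3) ℂ) 2 j = ((((t : ↥(Subgroup.centralizer ({γ} : Set ↥(unitaryGroupOfForm (starRingEnd ℂ) (Matrix.of fun i j : Fin 3 => if i.val + j.val + 1 = 3 then (1 : ℂ) else 0))))) : ↥(unitaryGroupOfForm (starRingEnd ℂ) (Matrix.of fun i j : Fin 3 => if i.val + j.val + 1 = 3 then (1 : ℂ) else 0))) : GL (Fin 3) ℂ) : Matrix (Fin 3) (Fin 3) ℂ) 2 2 * ((g : GL (Fin 3) ℂ) : Matrix (Fin 3) (Fin 3) ℂ) 2 j := by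
  obtain ⟨h01, h02, h10, h12, h20, h21⟩ := centralizer_apply_eq_zero_of_diag hγ hαu huβ hαβ t
  simp only [Subgroup.coe_mul, Units.val_mul, Matrix.mul_apply, Fin.sum_univ_three, h01, h02, h20, h21, zero_mul, add_zero, zero_add]
  exact ⟨trivial, trivial⟩

/-- **The `Φ₃`-negative vector `v = e₀ − e₂` stays negative**: for `g ∈ U(Φ₃)(ℂ)` and `w = g v` (`w_i = g_{i0} − g_{i2}`),
`w̄₀ w₂ + |w₁|² + w̄₂ w₀ = v̄ᵀ Φ₃ v = −2`. [cite: Rogawski1990, §3.1 p. 19] -/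
theorem form_apply_col_zero_sub_col_two (g : ↥(unitaryGroupOfForm (starRingEnd ℂ) (Matrix.of fun i j : Fin 3 => if i.val + j.val + 1 = 3 then (1 : ℂ) else 0))) :
    (starRingEnd ℂ) (((g : GL (Fin 3) ℂ) : Matrix (Fin 3) (Fin 3) ℂ) 0 0 - ((g : GL (Fin 3) ℂ) : Matrix (Fin 3) (Fin 3) ℂ) 0 2) * (((g : GL (Fin 3) ℂ) : Matrix (Fin 3) (Fin 3) ℂ) 2 0 - ((g : GL (Fin 3) ℂ) : Matrix (Fin 3) (Fin 3) ℂ) 2 2) +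
      (starRingEnd ℂ) (((g : GL (Fin 3) ℂ) : Matrix (Fin 3) (Fin 3) ℂ) 1 0 - ((g : GL (Fin 3) ℂ) : Matrix (Fin 3) (Fin 3) ℂ) 1 2) * (((g : GL (Fin 3) ℂ) : Matrix (Fin 3) (Fin 3) ℂ) 1 0 - ((g : GL (Fin 3) ℂ) : Matrix (Fin 3) (Fin 3) ℂ) 1 2) +
      (starRingEnd ℂ) (((g : GL (Fin 3) ℂ) : Matrix (Fin 3) (Fin 3) ℂ) 2 0 - ((g : GL (Fin 3) ℂ) : Matrix (Fin 3) (Fin 3) ℂ) 2 2) * (((g : GL (Fin 3) ℂ) : Matrix (Fin 3) (Fin 3) ℂ) 0 0 - ((g : GL (Fin 3) ℂ) : Matrix (Fin 3) (Fin 3) ℂ) 0 2) = -2 := by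
  have hmem := mem_unitaryGroupOfForm_iff.1 g.2
  have e00 := congrArg (fun A => A 0 0) hmem
  have e02 := congrArg (fun A => A 0 2) hmem
  have e20 := congrArg (fun A => A 2 0) hmem
  have e22 := congrArg (fun A => A 2 2) hmem
  simp only [Matrix.mul_apply, Fin.sum_univ_three, Matrix.transpose_apply, Matrix.map_apply, Matrix.of_apply,
    Fin.val_zero, Fin.val_one, Fin.val_two, Fin.isValue] at e00 e02 e20 e22
  norm_num at e00 e02 e20 e22
  simp only [map_sub]
  linear_combination e00 - e02 - e20 + e22

/-- Both outer coordinates of `g(e₀ − e₂)` are non-zero: `g₀₀ ≠ g₀₂` and `g₂₀ ≠ g₂₂` for every `g ∈ U(Φ₃)(ℂ)` (a `Φ₃`-negative vector has `Re(w̄₀ w₂) < 0`).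
[cite: Rogawski1990, §3.1 p. 19] -/
theorem apply_zero_sub_ne_zero_and (g : ↥(unitaryGroupOfForm (starRingEnd ℂ) (Matrix.of fun i j : Fin 3 => if i.val + j.val + 1 = 3 then (1 : ℂ) else 0))) :
    ((g : GL (Fin 3) ℂ) : Matrix (Fin 3) (Fin 3) ℂ) 0 0 - ((g : GL (Fin 3) ℂ) : Matrix (Fin 3) (Fin 3) ℂ) 0 2 ≠ 0 ∧ ((g : GL (Fin 3) ℂ) : Matrix (Fin 3) (Fin 3) ℂ) 2 0 - ((g : GL (Fin 3) ℂ) : Matrix (Fin 3) (Fin 3) ℂ) 2 2 ≠ 0 := by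
  have h := form_apply_col_zero_sub_col_two g
  have key : ∀ z : ℂ, (starRingEnd ℂ) z * z ≠ -2 := by
    intro z hz
    rw [Complex.conj_mul', ← Complex.ofReal_pow] at hz
    have hre := congrArg Complex.re hz
    simp only [Complex.ofReal_re] at hre
    norm_num at hre
    nlinarith [sq_nonneg ‖z‖]
  constructor
  · intro h0
    rw [h0, map_zero, zero_mul, zero_add, mul_zero, add_zero] at h
    exact key _ h
  · intro h2
    rw [h2, mul_zero, zero_add, map_zero, zero_mul, add_zero] at h
    exact key _ h

/-- **`hspos`**: the slab function `s(g) = |g₀₀ − g₀₂| ∕ |g₂₀ − g₂₂|` is positive on `U(Φ₃)(ℂ)`. [cite: BeuzartPlessis2020Asterisque, §1.2 p. 21] -/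
theorem slabFun_pos (g : ↥(unitaryGroupOfForm (starRingEnd ℂ) (Matrix.of fun i j : Fin 3 => if i.val + j.val + 1 = 3 then (1 : ℂ) else 0))) :
    0 < ‖((g : GL (Fin 3) ℂ) : Matrix (Fin 3) (Fin 3) ℂ) 0 0 - ((g : GL (Fin 3) ℂ) : Matrix (Fin 3) (Fin 3) ℂ) 0 2‖ / ‖((g : GL (Fin 3) ℂ) : Matrix (Fin 3) (Fin 3) ℂ) 2 0 - ((g : GL (Fin 3) ℂ) : Matrix (Fin 3) (Fin 3) ℂ) 2 2‖ := by
  obtain ⟨h0, h2⟩ := apply_zero_sub_ne_zero_and g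
  exact div_pos (norm_pos_iff.2 h0) (norm_pos_iff.2 h2)

/-- **`hsm`**: the slab function is Borel. [folklore] [cite: BeuzartPlessis2020Asterisque, §1.2 p. 21] -/
theorem slabFun_measurable [MeasurableSpace ↥(unitaryGroupOfForm (starRingEnd ℂ) (Matrix.of fun i j : Fin 3 => if i.val + j.val + 1 = 3 then (1 : ℂ) else 0))] [BorelSpace ↥(unitaryGroupOfForm (starRingEnd ℂ) (Matrix.of fun i j : Fin 3 => if i.val + j.val + 1 = 3 then (1 : ℂ) else 0))] :
    Measurable fun g : ↥(unitaryGroupOfForm (starRingEnd ℂ) (Matrix.of fun i j : Fin 3 => if i.val + j.val + 1 = 3 then (1 : ℂ) else 0)) => ‖((g : GL (Fin 3) ℂ) : Matrix (Fin 3) (Fin 3) ℂ) 0 0 - ((g : GL (Fin 3) ℂ) : Matrix (Fin 3) (Fin 3) ℂ) 0 2‖ / ‖((g : GL (Fin 3) ℂ) : Matrix (Fin 3) (Fin 3) ℂ) 2 0 - ((g : GL (Fin 3) ℂ) : Matrix (Fin 3) (Fin 3) ℂ) 2 2‖ := by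
  have hc : Continuous fun g : ↥(unitaryGroupOfForm (starRingEnd ℂ) (Matrix.of fun i j : Fin 3 => if i.val + j.val + 1 = 3 then (1 : ℂ) else 0)) => ((g : GL (Fin 3) ℂ) : Matrix (Fin 3) (Fin 3) ℂ) := Units.continuous_val.comp continuous_subtype_val
  exact (((hc.matrix_elem 0 0).sub (hc.matrix_elem 0 2)).norm.measurable).div
    (((hc.matrix_elem 2 0).sub (hc.matrix_elem 2 2)).norm.measurable)

/-- **`hseq`**: `s(t g) = |t₀₀|² · s(g)` for `t` in the torus (rows `0, 2` of `t g` are `t₀₀ ·` row₀, `t₂₂ ·` row₂, and `|t₂₂| = |t₀₀|⁻¹`).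
[cite: BeuzartPlessis2020Asterisque, §1.2 p. 21] [cite: Rogawski1990, §3.6 p. 31] -/
theorem slabFun_centralizer_mul (hγ : ((γ : GL (Fin 3) ℂ) : Matrix (Fin 3) (Fin 3) ℂ) = !![α, 0, 0; 0, u, 0; 0, 0, β]) (hαu : α ≠ u) (huβ : u ≠ β) (hαβ : α ≠ β)
    (t : ↥(Subgroup.centralizer ({γ} : Set ↥(unitaryGroupOfForm (starRingEnd ℂ) (Matrix.of fun i j : Fin 3 => if i.val + j.val + 1 = 3 then (1 : ℂ) else 0))))) (g : ↥(unitaryGroupOfForm (starRingEnd ℂ) (Matrix.of fun i j : Fin 3 => if i.val + j.val + 1 = 3 then (1 : ℂ) else 0))) :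
    ‖((((t : ↥(unitaryGroupOfForm (starRingEnd ℂ) (Matrix.of fun i j : Fin 3 => if i.val + j.val + 1 = 3 then (1 : ℂ) else 0))) * g : ↥(unitaryGroupOfForm (starRingEnd ℂ) (Matrix.of fun i j : Fin 3 => if i.val + j.val + 1 = 3 then (1 : ℂ) else 0))) : GL (Fin 3) ℂ) : Matrix (Fin 3) (Fin 3) ℂ) 0 0 - ((((t : ↥(unitaryGroupOfForm (starRingEnd ℂ) (Matrix.of fun i j : Fin 3 => if i.val + j.val + 1 = 3 then (1 : ℂ) else 0))) * g : ↥(unitaryGroupOfForm (starRingEnd ℂ) (Matrix.of fun i j : Fin 3 => if i.val + j.val + 1 = 3 then (1 : ℂ) else 0))) : GL (Fin 3) ℂ) : Matrix (Fin 3) (Fin 3) ℂ) 0 2‖ / ‖((((t : ↥(unitaryGroupOfForm (starRingEnd ℂ) (Matrix.of fun i j : Fin 3 => if i.val + j.val + 1 = 3 then (1 : ℂ) else 0))) * g : ↥(unitaryGroupOfForm (starRingEnd ℂ) (Matrix.of fun i j : Fin 3 => if i.val + j.val + 1 = 3 then (1 : ℂ) else 0))) : GL (Fin 3) ℂ) :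 Matrix (Fin 3) (Fin 3) ℂ) 2 0 - ((((t : ↥(unitaryGroupOfForm (starRingEnd ℂ) (Matrix.of fun i j : Fin 3 => if i.val + j.val + 1 = 3 then (1 : ℂ) else 0))) * g : ↥(unitaryGroupOfForm (starRingEnd ℂ) (Matrix.of fun i j : Fin 3 => if i.val + j.val + 1 = 3 then (1 : ℂ) else 0))) : GL (Fin 3) ℂ) : Matrix (Fin 3) (Fin 3) ℂ) 2 2‖ =
      ‖((((t : ↥(Subgroup.centralizer ({γ} : Set ↥(unitaryGroupOfForm (starRingEnd ℂ) (Matrix.of fun i j : Fin 3 => if i.val + j.val + 1 = 3 then (1 : ℂ) else 0))))) : ↥(unitaryGroupOfForm (starRingEnd ℂ) (Matrix.of fun i j : Fin 3 => if i.val + j.val + 1 = 3 then (1 : ℂ) else 0))) : GL (Fin 3) ℂ) : Matrix (Fin 3) (Fin 3) ℂ) 0 0‖ ^ 2 * (‖((g : GL (Fin 3) ℂ) : Matrix (Fin 3) (Fin 3) ℂ) 0 0 - ((g : GL (Fin 3) ℂ) : Matrix (Fin 3) (Fin 3) ℂ) 0 2‖ / ‖((g : GL (Fin 3) ℂ) :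 Matrix (Fin 3) (Fin 3) ℂ) 2 0 - ((g : GL (Fin 3) ℂ) : Matrix (Fin 3) (Fin 3) ℂ) 2 2‖) := by
  have h0 := centralizer_mul_apply hγ hαu huβ hαβ t g 0
  have h2 := centralizer_mul_apply hγ hαu huβ hαβ t g 2
  rw [h0.1, h2.1, h0.2, h2.2, ← mul_sub, ← mul_sub, norm_mul, norm_mul]
  have hprod := centralizer_norm_mul_norm_eq_one hγ hαu huβ hαβ t
  have hne := centralizer_norm_apply_zero_ne_zero hγ hαu huβ hαβ t
  obtain ⟨-, hw2⟩ := apply_zero_sub_ne_zero_and g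
  have hw2' : ‖((g : GL (Fin 3) ℂ) : Matrix (Fin 3) (Fin 3) ℂ) 2 0 - ((g : GL (Fin 3) ℂ) : Matrix (Fin 3) (Fin 3) ℂ) 2 2‖ ≠ 0 := norm_ne_zero_iff.2 hw2
  have h22 : ‖((((t : ↥(Subgroup.centralizer ({γ} : Set ↥(unitaryGroupOfForm (starRingEnd ℂ) (Matrix.of fun i j : Fin 3 => if i.val + j.val + 1 = 3 then (1 : ℂ) else 0))))) : ↥(unitaryGroupOfForm (starRingEnd ℂ) (Matrix.of fun i j : Fin 3 => if i.val + j.val + 1 = 3 then (1 : ℂ) else 0))) : GL (Fin 3) ℂ) : Matrix (Fin 3) (Fin 3) ℂ) 2 2‖ = ‖((((t : ↥(Subgroup.centralizer ({γ} : Set ↥(unitaryGroupOfForm (starRingEnd ℂ) (Matrix.of fun i j : Fin 3 => if i.val + j.val + 1 = 3 then (1 : ℂ) else 0))))) : ↥(unitaryGroupOfForm (starRingEnd ℂ) (Matrix.of fun i j : Fin 3 => if i.val + j.val + 1 = 3 then (1 : ℂ) else 0))) : GL (Fin 3) ℂ) : Matrix (Fin 3) (Fin 3) ℂ) 0 0‖⁻¹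 := eq_inv_of_mul_eq_one_right hprod
  rw [h22]
  field_simp

end Torus

/-! ## §3 The box in the hyperboloid chart: `|W|² ≤ K √(R+1)` on the chart-preimage of the orbit ball ∩ slab -/

section Box

/-- The real part of the slab: `|W₀ − N| ≤ |W₀ + N| ≤ 2|W₀ − N|` with `N² = 1 + |W₀|² + |W₁|²` forces `0 ≤ Re W₀ ≤ 1∕2 + (5∕4)|Im W₀| + |W₁|∕2`.
[cite: BeuzartPlessis2020Asterisque, §1.2 p. 21] -/
private theorem re_bounds_of_slab {a b m N : ℝ} (hm : 0 ≤ m) (hN : 0 < N) (hN2 : N ^ 2 = 1 + a ^ 2 + b ^ 2 + m)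
    (h1 : (a - N) ^ 2 + b ^ 2 ≤ (a + N) ^ 2 + b ^ 2) (h2 : (a + N) ^ 2 + b ^ 2 ≤ 4 * ((a - N) ^ 2 + b ^ 2)) :
    0 ≤ a ∧ a ≤ 1 / 2 + 5 / 4 * |b| + Real.sqrt m / 2 := by
  have ha : 0 ≤ a := by nlinarith
  refine ⟨ha, ?_⟩
  have hbabs : |b| ≤ N := by
    rw [← Real.sqrt_sq (abs_nonneg b), ← Real.sqrt_sq hN.le, sq_abs]
    exact Real.sqrt_le_sqrt (by nlinarith [sq_nonneg a])
  have habs : 0 ≤ |b| := abs_nonneg b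
  -- `3a ≤ N + (3/2)|b|`
  have h3 : 3 * a ≤ N + 3 / 2 * |b| := by
    by_cases hc : 3 * a - N ≤ 0
    · linarith
    · push Not at hc
      have hprod : (3 * a - N) * (3 * N - a) ≤ 3 * b ^ 2 := by nlinarith
      have h3N : 2 * N ≤ 3 * N - a := by nlinarith
      have hb2 : b ^ 2 = |b| ^ 2 := (sq_abs b).symm
      have : (3 * a - N) * (2 * N) ≤ 3 * |b| * N := by
        calc (3 * a - N) * (2 * N) ≤ (3 * a - N) * (3 * N - a) := by nlinarith
          _ ≤ 3 * b ^ 2 := hprod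
          _ = 3 * |b| * |b| := by rw [hb2]; ring
          _ ≤ 3 * |b| * N := by nlinarith
      nlinarith
  -- `N ≤ 1 + a + |b| + √m`
  have hsm : 0 ≤ Real.sqrt m := Real.sqrt_nonneg m
  have hsm2 : Real.sqrt m ^ 2 = m := Real.sq_sqrt hm
  have hN' : N ≤ 1 + a + |b| + Real.sqrt m := by
    have hsq : N ^ 2 ≤ (1 + a + |b| + Real.sqrt m) ^ 2 := by
      rw [hN2]
      nlinarith [sq_abs b, mul_nonneg ha habs, mul_nonneg ha hsm, mul_nonneg habs hsm]
    nlinarith [sq_nonneg (N - (1 + a + |b| + Real.sqrt m)), sq_nonneg (N + (1 + a + |b| + Real.sqrt m))]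
  nlinarith

/-- `(x + y + z)² ≤ 3(x² + y² + z²)`. [folklore] -/
private theorem sq_add_three_le (x y z : ℝ) : (x + y + z) ^ 2 ≤ 3 * (x ^ 2 + y ^ 2 + z ^ 2) := by
  nlinarith [sq_nonneg (x - y), sq_nonneg (y - z), sq_nonneg (x - z)]

/-- The complex heart of the box: for `Φ = −p(1+m) + u·m − 2i·q·N·b` with `p = (α + ᾱ⁻¹)∕2`, `q = (α − ᾱ⁻¹)∕2`, `|u| = 1`, `α ≠ 0`:
`(|α| − 1)²∕2 · m ≤ |α|·|Φ|` and `||α|² − 1| · N · |b| ≤ |α| (|Φ| + m)` (multiply by `ᾱ`: `ᾱ p = (|α|²+1)∕2`, `ᾱ q = (|α|²−1)∕2` are REAL).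
[cite: BeuzartPlessis2020Asterisque, §1.2 (1.2.2), (1.2.4) p. 21] -/
private theorem box_core {α u : ℂ} (hα : α ≠ 0) (hu : ‖u‖ = 1) {m N b : ℝ} (hm : 0 ≤ m) (hN : 0 ≤ N) :
    (‖α‖ - 1) ^ 2 / 2 * m ≤ ‖α‖ * ‖-((α + (star α)⁻¹) / 2) * (1 + (m : ℂ)) + u * (m : ℂ) - 2 * Complex.I * ((α - (star α)⁻¹) / 2) * (N : ℂ) * (b : ℂ)‖ ∧
      |‖α‖ ^ 2 - 1| * (N * |b|) ≤ ‖α‖ * (‖-((α + (star α)⁻¹) / 2) * (1 + (m : ℂ)) + u * (m : ℂ) - 2 * Complex.I * ((α - (star α)⁻¹) / 2) * (N : ℂ) * (b : ℂ)‖ + m) := by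
  set Φ : ℂ := -((α + (star α)⁻¹) / 2) * (1 + (m : ℂ)) + u * (m : ℂ) - 2 * Complex.I * ((α - (star α)⁻¹) / 2) * (N : ℂ) * (b : ℂ) with hΦ
  have hc : star α ≠ 0 := star_ne_zero.2 hα
  have hcα : star α * α = ((‖α‖ ^ 2 : ℝ) : ℂ) := by
    rw [Complex.star_def, Complex.conj_mul', Complex.ofReal_pow]
  -- `ᾱ Φ = A + B i` with `A, B` real
  set ω : ℂ := star α * u with hω
  have hωn : ‖ω‖ = ‖α‖ := by rw [hω, norm_mul, norm_star, hu, mul_one]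
  set A : ℝ := -((‖α‖ ^ 2 + 1) / 2) * (1 + m) + m * ω.re with hA
  set B : ℝ := m * ω.im - (‖α‖ ^ 2 - 1) * N * b with hB
  have key : star α * Φ = (A : ℂ) + (B : ℂ) * Complex.I := by
    have h1 : star α * ((α + (star α)⁻¹) / 2) = (((‖α‖ ^ 2 + 1) / 2 : ℝ) : ℂ) := by
      rw [mul_div_assoc', mul_add, hcα, mul_inv_cancel₀ hc]
      push_cast
      ring
    have h2 : star α * ((α - (star α)⁻¹) / 2) = (((‖α‖ ^ 2 - 1) / 2 : ℝ) : ℂ) := by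
      rw [mul_div_assoc', mul_sub, hcα, mul_inv_cancel₀ hc]
      push_cast
      ring
    have hωe : ω = (ω.re : ℂ) + (ω.im : ℂ) * Complex.I := (Complex.re_add_im ω).symm
    calc star α * Φ = -(star α * ((α + (star α)⁻¹) / 2)) * (1 + (m : ℂ)) + (star α * u) * (m : ℂ)
          - 2 * Complex.I * (star α * ((α - (star α)⁻¹) / 2)) * (N : ℂ) * (b : ℂ) := by rw [hΦ]; ring
      _ = -(((‖α‖ ^ 2 + 1) / 2 : ℝ) : ℂ) * (1 + (m : ℂ)) + ω * (m : ℂ) - 2 * Complex.I * (((‖α‖ ^ 2 - 1) / 2 : ℝ) : ℂ) * (N : ℂ) * (b : ℂ) := by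
          rw [h1, h2, hω]
      _ = (A : ℂ) + (B : ℂ) * Complex.I := by
          rw [hωe, hA, hB]
          push_cast
          ring
  have hnorm : ‖star α * Φ‖ = ‖α‖ * ‖Φ‖ := by rw [norm_mul, norm_star]
  have hAle : |A| ≤ ‖α‖ * ‖Φ‖ := by
    rw [← hnorm, key]
    simpa using Complex.abs_re_le_norm ((A : ℂ) + (B : ℂ) * Complex.I)
  have hBle : |B| ≤ ‖α‖ * ‖Φ‖ := by
    rw [← hnorm, key]
    simpa using Complex.abs_im_le_norm ((A : ℂ) + (B : ℂ) * Complex.I)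
  have hωre : |ω.re| ≤ ‖α‖ := hωn ▸ Complex.abs_re_le_norm ω
  have hωim : |ω.im| ≤ ‖α‖ := hωn ▸ Complex.abs_im_le_norm ω
  constructor
  · -- the `m`-bound from the real part
    have hre : ω.re ≤ ‖α‖ := (le_abs_self _).trans hωre
    have h1 : -A ≤ ‖α‖ * ‖Φ‖ := (neg_le_abs A).trans hAle
    have hA' : -A = (‖α‖ ^ 2 + 1) / 2 * (1 + m) - m * ω.re := by rw [hA]; ring
    have hstep : (‖α‖ - 1) ^ 2 / 2 * m ≤ (‖α‖ ^ 2 + 1) / 2 * (1 + m) - m * ω.re := by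
      nlinarith [mul_le_mul_of_nonneg_left hre hm, sq_nonneg ‖α‖, norm_nonneg α]
    linarith
  · -- the `b`-bound from the imaginary part
    have h1 : |(‖α‖ ^ 2 - 1) * N * b| ≤ |m * ω.im| + |B| := by
      have : (‖α‖ ^ 2 - 1) * N * b = m * ω.im - B := by rw [hB]; ring
      rw [this]
      exact abs_sub _ _
    have h2 : |m * ω.im| ≤ ‖α‖ * m := by
      rw [abs_mul, abs_of_nonneg hm, mul_comm]
      exact mul_le_mul_of_nonneg_right hωim hm
    have h3 : |(‖α‖ ^ 2 - 1) * N * b| = |‖α‖ ^ 2 - 1| * (N * |b|) := by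
      rw [abs_mul, abs_mul, abs_of_nonneg hN, mul_assoc]
    rw [← h3]
    nlinarith

/-- The quadratic form of the orbit ball in the hyperboloid chart: `Σ \overline{ẑ_i} J_{ii} (γ_J)_{ij} ẑ_j = N⁻² · Φ(W)` for `z = W∕N`, `N = √(1+|W|²)`, with
`Φ(W) = −p(1+|W₁|²) + u|W₁|² − 2i q N Im W₀`, `p = (α + ᾱ⁻¹)∕2`, `q = (α − ᾱ⁻¹)∕2`. [cite: Rudin1980, §2.2] -/
private theorem chart_quadForm_eq (α u : ℂ) (W : Fin 2 → ℂ) :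
    ∑ i : Fin 3, ∑ j : Fin 3, star (lift (proj ![W 0, W 1, (Real.sqrt (1 + nsq W) : ℂ)] (Q_vecCons_sqrt_one_add_nsq_neg W)) i) * J i i * (!![(α + (star α)⁻¹) / 2, 0, (α - (star α)⁻¹) / 2; 0, u, 0; (α - (star α)⁻¹) / 2, 0, (α + (star α)⁻¹) / 2] : Matrix (Fin 3) (Fin 3) ℂ) i j * lift (proj ![W 0, W 1, (Real.sqrt (1 + nsq W) : ℂ)] (Q_vecCons_sqrt_one_add_nsq_neg W)) j = (((Real.sqrt (1 + nsq W) : ℝ) : ℂ) ^ 2)⁻¹ * (-((α + (star α)⁻¹) / 2) * (1 + ((‖W 1‖ ^ 2 : ℝ) : ℂ)) + u * ((‖W 1‖ ^ 2 : ℝ) : ℂ) - 2 * Complex.I * ((α - (star α)⁻¹) / 2) * ((Real.sqrt (1 + nsq W) : ℝ) : ℂ) * (((W 0).im : ℝ) : ℂ)) := by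
  set N : ℝ := Real.sqrt (1 + nsq W) with hNdef
  have hN0 : 0 < 1 + nsq W := by linarith [nsq_nonneg W]
  have hN : 0 < N := Real.sqrt_pos.2 hN0
  have hN2 : N ^ 2 = 1 + nsq W := Real.sq_sqrt hN0.le
  have hNC : (N : ℂ) ≠ 0 := Complex.ofReal_ne_zero.2 hN.ne'
  have hz : (proj ![W 0, W 1, (Real.sqrt (1 + nsq W) : ℂ)] (Q_vecCons_sqrt_one_add_nsq_neg W)).1 = N⁻¹ • W := coe_proj_vecCons_sqrt W
  have hz0 : (proj ![W 0, W 1, (Real.sqrt (1 + nsq W) : ℂ)] (Q_vecCons_sqrt_one_add_nsq_neg W)).1 0 = (N : ℂ)⁻¹ * W 0 := by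
    rw [hz, Pi.smul_apply, Complex.real_smul, Complex.ofReal_inv]
  have hz1 : (proj ![W 0, W 1, (Real.sqrt (1 + nsq W) : ℂ)] (Q_vecCons_sqrt_one_add_nsq_neg W)).1 1 = (N : ℂ)⁻¹ * W 1 := by
    rw [hz, Pi.smul_apply, Complex.real_smul, Complex.ofReal_inv]
  have hW0 : W 0 = ((W 0).re : ℂ) + ((W 0).im : ℂ) * Complex.I := (Complex.re_add_im (W 0)).symm
  have hN2C : ((N : ℂ)) ^ 2 = 1 + ((W 0).re : ℂ) ^ 2 + ((W 0).im : ℂ) ^ 2 + ((‖W 1‖ ^ 2 : ℝ) : ℂ) := by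
    rw [← Complex.ofReal_pow, hN2, nsq, ← Complex.normSq_eq_norm_sq (W 0), Complex.normSq_apply]
    push_cast
    ring
  simp only [Fin.sum_univ_three, lift_0, lift_1, lift_2, hz0, hz1, J, Matrix.diagonal_apply_eq,
    Matrix.of_apply, Matrix.cons_val', Matrix.cons_val_zero, Matrix.cons_val_one, Matrix.cons_val_two, Matrix.empty_val', Matrix.cons_val_fin_one,
    Matrix.head_cons, Matrix.head_fin_const, Matrix.tail_cons]
  -- all `star`s to `conj`, `conj (N⁻¹ W) = N⁻¹ conj W`
  simp only [star_mul', Complex.star_def, map_inv₀, Complex.conj_ofReal, map_one]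
  have hx : ((N : ℂ))⁻¹ * (N : ℂ) = 1 := inv_mul_cancel₀ hNC
  have hS : (starRingEnd ℂ) (W 0) * W 0 + 1 + ((‖W 1‖ ^ 2 : ℝ) : ℂ) = (N : ℂ) ^ 2 := by
    rw [Complex.conj_mul', ← Complex.ofReal_pow, Complex.sq_norm, Complex.normSq_apply, hN2C]
    push_cast
    ring
  have hd : (starRingEnd ℂ) (W 0) - W 0 = -2 * ((W 0).im : ℂ) * Complex.I := by
    apply Complex.ext
    · simp
    · simp; ring
  have hW1' : (starRingEnd ℂ) (W 1) * W 1 = ((‖W 1‖ ^ 2 : ℝ) : ℂ) := by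
    rw [Complex.conj_mul', Complex.ofReal_pow]
  linear_combination (((N : ℂ))⁻¹ ^ 2 * u) * hW1' + (((N : ℂ))⁻¹ ^ 2 * ((α + ((starRingEnd ℂ) α)⁻¹) / 2)) * hS
    + (((N : ℂ))⁻¹ * ((α - ((starRingEnd ℂ) α)⁻¹) / 2)) * hd
    + (((α + ((starRingEnd ℂ) α)⁻¹) / 2) * (((N : ℂ))⁻¹ * (N : ℂ) + 1) + 2 * Complex.I * ((α - ((starRingEnd ℂ) α)⁻¹) / 2) * ((W 0).im : ℂ) * ((N : ℂ))⁻¹) * hx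

/-- From the orbit-ball inequality in the chart, `|Φ(W)| ≤ √(R+1)∕2` (`1 − |z|² = N⁻²`, ★ `one_sub_nsq_inv_sqrt_one_add_nsq_smul`). [cite: Rudin1980, §2.2] -/
private theorem norm_chartPhi_le {α u : ℂ} {R : ℝ} (hR : 0 ≤ R) {W : Fin 2 → ℂ}
    (hball : 4 * ‖∑ i : Fin 3, ∑ j : Fin 3, star (lift (proj ![W 0, W 1, (Real.sqrt (1 + nsq W) : ℂ)] (Q_vecCons_sqrt_one_add_nsq_neg W)) i) * J i i * (!![(α + (star α)⁻¹) / 2, 0, (α - (star α)⁻¹) / 2; 0, u, 0; (α - (star α)⁻¹) / 2, 0, (α + (star α)⁻¹) / 2] : Matrix (Fin 3) (Fin 3) ℂ) i j * lift (proj ![W 0, W 1, (Real.sqrt (1 + nsq W) : ℂ)] (Q_vecCons_sqrt_one_add_nsq_neg W)) j‖ ^ 2 ≤ (R + 1) * (1 - nsq (proj ![W 0, W 1, (Real.sqrt (1 + nsq W) : ℂ)] (Q_vecCons_sqrt_one_add_nsq_neg W)).1) ^ 2) :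
    ‖(-((α + (star α)⁻¹) / 2) * (1 + ((‖W 1‖ ^ 2 : ℝ) : ℂ)) + u * ((‖W 1‖ ^ 2 : ℝ) : ℂ) - 2 * Complex.I * ((α - (star α)⁻¹) / 2) * ((Real.sqrt (1 + nsq W) : ℝ) : ℂ) * (((W 0).im : ℝ) : ℂ))‖ ≤ Real.sqrt (R + 1) / 2 := by
  set N : ℝ := Real.sqrt (1 + nsq W) with hNdef
  set Φ : ℂ := (-((α + (star α)⁻¹) / 2) * (1 + ((‖W 1‖ ^ 2 : ℝ) : ℂ)) + u * ((‖W 1‖ ^ 2 : ℝ) : ℂ) - 2 * Complex.I * ((α - (star α)⁻¹) / 2) * ((Real.sqrt (1 + nsq W) : ℝ) : ℂ) * (((W 0).im : ℝ) : ℂ)) with hΦ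
  have hN0 : 0 < 1 + nsq W := by linarith [nsq_nonneg W]
  have hN2 : N ^ 2 = 1 + nsq W := Real.sq_sqrt hN0.le
  have h1m : 1 - nsq (proj ![W 0, W 1, (Real.sqrt (1 + nsq W) : ℂ)] (Q_vecCons_sqrt_one_add_nsq_neg W)).1 = (N ^ 2)⁻¹ := by
    rw [coe_proj_vecCons_sqrt W, one_sub_nsq_inv_sqrt_one_add_nsq_smul, hN2]
  rw [chart_quadForm_eq, h1m] at hball
  have hN2pos : 0 < N ^ 2 := by rw [hN2]; exact hN0
  have hn : ‖((N : ℂ) ^ 2)⁻¹ * Φ‖ = (N ^ 2)⁻¹ * ‖Φ‖ := by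
    rw [norm_mul, norm_inv, ← Complex.ofReal_pow, Complex.norm_real, Real.norm_eq_abs, abs_of_pos hN2pos]
  rw [hn] at hball
  have h4 : 4 * ‖Φ‖ ^ 2 ≤ R + 1 := by
    have h' : 4 * ((N ^ 2)⁻¹ * ‖Φ‖) ^ 2 = (4 * ‖Φ‖ ^ 2) * ((N ^ 2)⁻¹) ^ 2 := by ring
    rw [h'] at hball
    exact le_of_mul_le_mul_right hball (by positivity)
  have hsq : ‖Φ‖ ^ 2 ≤ (Real.sqrt (R + 1) / 2) ^ 2 := by
    rw [div_pow, Real.sq_sqrt (by linarith)]; linarith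
  exact (pow_le_pow_iff_left₀ (norm_nonneg _) (by positivity) two_ne_zero).1 hsq

/-- From the slab in the chart, the two real inequalities `|W₀ − N|² ≤ |W₀ + N|² ≤ 4|W₀ − N|²` in the coordinates `a = Re W₀`, `b = Im W₀`. [cite: Rudin1980, §2.2] -/
private theorem slab_sq_of_chart {W : Fin 2 → ℂ}
    (hslab : ‖(proj ![W 0, W 1, (Real.sqrt (1 + nsq W) : ℂ)] (Q_vecCons_sqrt_one_add_nsq_neg W)).1 0 + 1‖ / ‖(proj ![W 0, W 1, (Real.sqrt (1 + nsq W) : ℂ)] (Q_vecCons_sqrt_one_add_nsq_neg W)).1 0 - 1‖ ∈ Icc (1 : ℝ) 2) :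
    ((W 0).re - Real.sqrt (1 + nsq W)) ^ 2 + (W 0).im ^ 2 ≤ ((W 0).re + Real.sqrt (1 + nsq W)) ^ 2 + (W 0).im ^ 2 ∧
      ((W 0).re + Real.sqrt (1 + nsq W)) ^ 2 + (W 0).im ^ 2 ≤ 4 * (((W 0).re - Real.sqrt (1 + nsq W)) ^ 2 + (W 0).im ^ 2) := by
  set N : ℝ := Real.sqrt (1 + nsq W) with hNdef
  have hN0 : 0 < 1 + nsq W := by linarith [nsq_nonneg W]
  have hN : 0 < N := Real.sqrt_pos.2 hN0
  have hz0 : (proj ![W 0, W 1, (Real.sqrt (1 + nsq W) : ℂ)] (Q_vecCons_sqrt_one_add_nsq_neg W)).1 0 = (N : ℂ)⁻¹ * W 0 := by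
    rw [coe_proj_vecCons_sqrt W, Pi.smul_apply, Complex.real_smul, Complex.ofReal_inv]
  have hW0 : W 0 = ((W 0).re : ℂ) + ((W 0).im : ℂ) * Complex.I := (Complex.re_add_im (W 0)).symm
  rw [hz0] at hslab
  have hNC : (N : ℂ) ≠ 0 := Complex.ofReal_ne_zero.2 hN.ne'
  have hp : ((N : ℂ))⁻¹ * W 0 + 1 = ((N : ℂ))⁻¹ * (W 0 + N) := by field_simp
  have hq : ((N : ℂ))⁻¹ * W 0 - 1 = ((N : ℂ))⁻¹ * (W 0 - N) := by field_simp
  rw [hp, hq, norm_mul, norm_mul, norm_inv, Complex.norm_real, Real.norm_eq_abs, abs_of_pos hN] at hslab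
  have hplus : ‖W 0 + (N : ℂ)‖ ^ 2 = ((W 0).re + N) ^ 2 + (W 0).im ^ 2 := by
    rw [Complex.sq_norm, Complex.normSq_apply]; simp
    ring
  have hminus : ‖W 0 - (N : ℂ)‖ ^ 2 = ((W 0).re - N) ^ 2 + (W 0).im ^ 2 := by
    rw [Complex.sq_norm, Complex.normSq_apply]; simp
    ring
  obtain ⟨hs1, hs2⟩ := hslab
  have hden : 0 < N⁻¹ * ‖W 0 - (N : ℂ)‖ := by
    rcases (mul_nonneg (inv_nonneg.2 hN.le) (norm_nonneg (W 0 - (N : ℂ)))).eq_or_lt with h0 | h0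
    · rw [← h0, div_zero] at hs1; linarith
    · exact h0
  rw [le_div_iff₀ hden] at hs1
  rw [div_le_iff₀ hden] at hs2
  have hNi : 0 < N⁻¹ := inv_pos.2 hN
  have e1 : ‖W 0 - (N : ℂ)‖ ≤ ‖W 0 + (N : ℂ)‖ := by nlinarith
  have e2 : ‖W 0 + (N : ℂ)‖ ≤ 2 * ‖W 0 - (N : ℂ)‖ := by nlinarith
  constructor
  · rw [← hplus, ← hminus]
    exact pow_le_pow_left₀ (norm_nonneg _) e1 2
  · rw [← hplus, ← hminus]
    nlinarith [norm_nonneg (W 0 + (N : ℂ)), norm_nonneg (W 0 - (N : ℂ))]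

/-- **THE BOX.**  For `γ_J = !![p, 0, q; 0, u, 0; q, 0, p]` with `p = (α + ᾱ⁻¹)∕2`, `q = (α − ᾱ⁻¹)∕2` (the Sylvester image of `diag(α, u, ᾱ⁻¹)`), `|u| = 1`, `|α| ≠ 1`:
if the chart point `z = W∕√(1+|W|²)` satisfies the orbit-ball inequality `4|Σ \overline{ẑ_i} J_{ii} (γ_J)_{ij} ẑ_j|² ≤ (R+1)(1−|z|²)²` and the slab
`1 ≤ |z₀+1|∕|z₀−1| ≤ 2`, then `|W|² ≤ K(α) · √(R+1)` with the EXPLICIT `K(α) = 3∕4 + (91∕16)·K_b + (7∕4)·K_m`, `K_m = |α|∕(|α|−1)²`,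
`K_b = |α|(1∕2 + K_m)∕||α|²−1|`. [cite: BeuzartPlessis2020Asterisque, §1.2 (1.2.2), (1.2.4) p. 21] [cite: Rudin1980, §2.2] -/
theorem nsq_le_of_chart_mem_hsOrbitBall_slab {α u : ℂ} (hu : ‖u‖ = 1) (hα : α ≠ 0) (hα1 : ‖α‖ ≠ 1) {R : ℝ} (hR : 0 ≤ R)
    {W : Fin 2 → ℂ}
    (hball : 4 * ‖∑ i : Fin 3, ∑ j : Fin 3, star (lift (proj ![W 0, W 1, (Real.sqrt (1 + nsq W) : ℂ)] (Q_vecCons_sqrt_one_add_nsq_neg W)) i) * J i i * (!![(α + (star α)⁻¹) / 2, 0, (α - (star α)⁻¹) / 2; 0, u, 0; (α - (star α)⁻¹) / 2, 0, (α + (star α)⁻¹) / 2] : Matrix (Fin 3) (Fin 3) ℂ) i j * lift (proj ![W 0, W 1, (Real.sqrt (1 + nsq W) : ℂ)] (Q_vecCons_sqrt_one_add_nsq_neg W)) j‖ ^ 2 ≤ (R + 1) * (1 - nsq (proj ![W 0, W 1, (Real.sqrt (1 + nsq W) : ℂ)] (Q_vecCons_sqrt_one_add_nsq_neg W)).1)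 ^ 2)
    (hslab : ‖(proj ![W 0, W 1, (Real.sqrt (1 + nsq W) : ℂ)] (Q_vecCons_sqrt_one_add_nsq_neg W)).1 0 + 1‖ / ‖(proj ![W 0, W 1, (Real.sqrt (1 + nsq W) : ℂ)] (Q_vecCons_sqrt_one_add_nsq_neg W)).1 0 - 1‖ ∈ Icc (1 : ℝ) 2) :
    nsq W ≤ (3 / 4 + 91 / 16 * (‖α‖ * (1 / 2 + ‖α‖ / (‖α‖ - 1) ^ 2) / |‖α‖ ^ 2 - 1|) + 7 / 4 * (‖α‖ / (‖α‖ - 1) ^ 2)) * Real.sqrt (R + 1) := by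
  have hΦ' := norm_chartPhi_le hR hball
  obtain ⟨hs1, hs2⟩ := slab_sq_of_chart hslab
  set N : ℝ := Real.sqrt (1 + nsq W) with hNdef
  set a : ℝ := (W 0).re with ha
  set b : ℝ := (W 0).im with hb
  set m : ℝ := ‖W 1‖ ^ 2 with hm
  have hN0 : 0 < 1 + nsq W := by linarith [nsq_nonneg W]
  have hN : 0 < N := Real.sqrt_pos.2 hN0
  have hN2 : N ^ 2 = 1 + nsq W := Real.sq_sqrt hN0.le
  have hm0 : 0 ≤ m := by positivity
  have hnsq : nsq W = a ^ 2 + b ^ 2 + m := by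
    rw [nsq, hm, ← Complex.normSq_eq_norm_sq (W 0), Complex.normSq_apply, ha, hb]; ring
  obtain ⟨ha0, hale⟩ := re_bounds_of_slab hm0 hN (by rw [hN2, hnsq]; ring) hs1 hs2
  obtain ⟨hmb, hbb⟩ := box_core hα hu hm0 hN.le (N := N) (b := b) (m := m)
  set r : ℝ := Real.sqrt (R + 1) with hr
  have hr1 : 1 ≤ r := by rw [hr]; exact Real.one_le_sqrt.2 (by linarith)
  have hαpos : 0 < ‖α‖ := norm_pos_iff.2 hα
  have hd1 : 0 < (‖α‖ - 1) ^ 2 := by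
    have : ‖α‖ - 1 ≠ 0 := sub_ne_zero.2 hα1
    positivity
  have hd2 : 0 < |‖α‖ ^ 2 - 1| := by
    have : ‖α‖ ^ 2 - 1 ≠ 0 := by
      intro h
      exact hα1 ((pow_eq_one_iff_of_nonneg (norm_nonneg α) two_ne_zero).1 (by linarith))
    positivity
  -- `m ≤ K_m r`
  set Km : ℝ := ‖α‖ / (‖α‖ - 1) ^ 2 with hKm
  have hKm0 : 0 ≤ Km := by positivity
  have hmle : m ≤ Km * r := by
    have h1 : (‖α‖ - 1) ^ 2 / 2 * m ≤ ‖α‖ * (r / 2) := hmb.trans (mul_le_mul_of_nonneg_left hΦ' hαpos.le)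
    have h2 : m * (‖α‖ - 1) ^ 2 ≤ ‖α‖ * r := by linarith
    rw [hKm, div_mul_eq_mul_div, le_div_iff₀ hd1]
    linarith
  -- `b² ≤ K_b r`
  set Kb : ℝ := ‖α‖ * (1 / 2 + Km) / |‖α‖ ^ 2 - 1| with hKb
  have hKb0 : 0 ≤ Kb := by positivity
  have hb2N : b ^ 2 ≤ N ^ 2 := by nlinarith [sq_nonneg a]
  have hbabs : |b| ≤ N := abs_le_of_sq_le_sq hb2N hN.le
  have hb2le : b ^ 2 ≤ Kb * r := by
    have h1 : |‖α‖ ^ 2 - 1| * (N * |b|) ≤ ‖α‖ * (r / 2 + Km * r) := by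
      refine hbb.trans (mul_le_mul_of_nonneg_left ?_ hαpos.le)
      linarith
    have h2 : N * |b| ≤ Kb * r := by
      rw [hKb, div_mul_eq_mul_div, le_div_iff₀ hd2]
      have h3 : ‖α‖ * (r / 2 + Km * r) = ‖α‖ * (1 / 2 + Km) * r := by ring
      linarith
    calc b ^ 2 = |b| * |b| := by rw [← sq_abs]; ring
      _ ≤ N * |b| := mul_le_mul_of_nonneg_right hbabs (abs_nonneg b)
      _ ≤ Kb * r := h2
  -- `a² ≤ 3/4 + (75/16) b² + (3/4) m`
  have ha2 : a ^ 2 ≤ 3 / 4 + 75 / 16 * b ^ 2 + 3 / 4 * m := by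
    have h1 : a ^ 2 ≤ (1 / 2 + 5 / 4 * |b| + Real.sqrt m / 2) ^ 2 := pow_le_pow_left₀ ha0 hale 2
    have h2 := sq_add_three_le (1 / 2) (5 / 4 * |b|) (Real.sqrt m / 2)
    have h3 : (5 / 4 * |b|) ^ 2 = 25 / 16 * b ^ 2 := by rw [mul_pow, sq_abs]; ring
    have h4 : (Real.sqrt m / 2) ^ 2 = m / 4 := by rw [div_pow, Real.sq_sqrt hm0]; ring
    rw [h3, h4] at h2
    linarith
  -- assemble
  rw [hnsq]
  have hK : (3 / 4 + 91 / 16 * Kb + 7 / 4 * Km) * r = 3 / 4 * r + 91 / 16 * (Kb * r) + 7 / 4 * (Km * r) := by ring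
  have h34 : (3 : ℝ) / 4 ≤ 3 / 4 * r := by linarith
  rw [hK]
  linarith

end Box

/-! ## §4 The ball picture: the orbit ball ∩ slab is the Sylvester–orbit-map preimage of an explicit `D_R ⊂ 𝔹²`; its Haar mass -/

section BallPicture

/-- The Sylvester image of the diagonal representative: `T · diag(α, u, β) · T = !![(α+β)∕2, 0, (α−β)∕2; 0, u, 0; (α−β)∕2, 0, (α+β)∕2]` (a phase-twisted BOOST
in the `(e₀, e₂)`-plane of the ball model — the «hyp(v,u,s)» dictionary: `α = v eˢ`, `β = ᾱ⁻¹ = v e⁻ˢ`). [cite: Rogawski1990, §3.6 p. 31] [cite: Rudin1980, §2.2] -/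
private theorem sylv_conj_diagonal (α u β : ℂ) :
    (!![((Real.sqrt 2)⁻¹ : ℂ), 0, ((Real.sqrt 2)⁻¹ : ℂ); 0, 1, 0; ((Real.sqrt 2)⁻¹ : ℂ), 0, -((Real.sqrt 2)⁻¹ : ℂ)] : Matrix (Fin 3) (Fin 3) ℂ) * !![α, 0, 0; 0, u, 0; 0, 0, β] * (!![((Real.sqrt 2)⁻¹ : ℂ), 0, ((Real.sqrt 2)⁻¹ : ℂ); 0, 1, 0; ((Real.sqrt 2)⁻¹ : ℂ), 0, -((Real.sqrt 2)⁻¹ : ℂ)] : Matrix (Fin 3) (Fin 3) ℂ) =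
      !![(α + β) / 2, 0, (α - β) / 2; 0, u, 0; (α - β) / 2, 0, (α + β) / 2] := by
  have h2 := sqrt_two_inv_mul_self
  ext i j
  fin_cases i <;> fin_cases j <;> simp [Matrix.mul_apply, Fin.sum_univ_three] <;>
    first
    | linear_combination (α + β) * h2
    | linear_combination (α - β) * h2

/-- `vol_{ℂ²}{|W|² ≤ s} ≤ vol(B(0,1)) · s²` for `s ≥ 0` (`{|W|² ≤ s} ⊆ B̄(0, √s)` in the sup norm, `Measure.addHaar_closedBall`, `dim_ℝ ℂ² = 4`; re-derivation of the private
lemma of ★ `ArchUnitaryThreeHaarHSBall`). [folklore] -/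
private theorem volume_setOf_nsq_le_le' {s : ℝ} (hs : 0 ≤ s) :
    volume {W : Fin 2 → ℂ | nsq W ≤ s} ≤ ENNReal.ofReal (s ^ 2) * volume (Metric.ball (0 : Fin 2 → ℂ) 1) := by
  have hsub : {W : Fin 2 → ℂ | nsq W ≤ s} ⊆ Metric.closedBall 0 (Real.sqrt s) := by
    intro W hW
    rw [mem_closedBall_zero_iff, pi_norm_le_iff_of_nonneg (Real.sqrt_nonneg s)]
    intro i
    have hW' : nsq W ≤ s := hW
    have hi : ‖W i‖ ^ 2 ≤ s := by
      have h' : ‖W i‖ ^ 2 ≤ nsq W := by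
        fin_cases i
        · show ‖W 0‖ ^ 2 ≤ nsq W
          unfold nsq
          linarith [sq_nonneg ‖W 1‖]
        · show ‖W 1‖ ^ 2 ≤ nsq W
          unfold nsq
          linarith [sq_nonneg ‖W 0‖]
      exact h'.trans hW'
    have := Real.abs_le_sqrt hi
    rwa [abs_of_nonneg (norm_nonneg _)] at this
  have hdim : Module.finrank ℝ (Fin 2 → ℂ) = 4 := by
    rw [Module.finrank_pi_fintype]
    simp [Complex.finrank_real_complex]
  refine (measure_mono hsub).trans ?_
  rw [Measure.addHaar_closedBall volume (0 : Fin 2 → ℂ) (Real.sqrt_nonneg s), hdim]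
  have h4 : Real.sqrt s ^ 4 = s ^ 2 := by
    rw [show (4 : ℕ) = 2 * 2 from rfl, pow_mul, Real.sq_sqrt hs]
  rw [h4]

/-- The set `D_R(γ_J) ∩ SLAB ⊂ 𝔹²` is Borel. [folklore] -/
private theorem measurableSet_D (α u : ℂ) (R : ℝ) : MeasurableSet {z : Ball | 4 * ‖∑ i : Fin 3, ∑ j : Fin 3, star (lift z i) * J i i * (!![(α + (star α)⁻¹) / 2, 0, (α - (star α)⁻¹) / 2; 0, u, 0; (α - (star α)⁻¹) / 2, 0, (α + (star α)⁻¹) / 2] : Matrix (Fin 3) (Fin 3) ℂ) i j * lift z j‖ ^ 2 ≤ (R + 1) * (1 - nsq z.1) ^ 2 ∧ ‖z.1 0 + 1‖ / ‖z.1 0 - 1‖ ∈ Icc (1 : ℝ) 2} := by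
  have hz0 : Continuous fun z : Ball => z.1 0 := (continuous_apply 0).comp continuous_subtype_val
  have hz1 : Continuous fun z : Ball => z.1 1 := (continuous_apply 1).comp continuous_subtype_val
  have hl : ∀ i : Fin 3, Continuous fun z : Ball => lift z i := by
    intro i
    fin_cases i
    · exact hz0.congr fun z => (lift_0 z).symm
    · exact hz1.congr fun z => (lift_1 z).symm
    · exact continuous_const.congr fun z => (lift_2 z).symm
  have hQ : Continuous fun z : Ball => ∑ i : Fin 3, ∑ j : Fin 3, star (lift z i) * J i i * (!![(α + (star α)⁻¹) / 2, 0, (α - (star α)⁻¹) / 2; 0, u, 0; (α - (star α)⁻¹) / 2, 0, (α + (star α)⁻¹) / 2] : Matrix (Fin 3) (Fin 3) ℂ) i j * lift z j :=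
    continuous_finsetSum _ fun i _ => continuous_finsetSum _ fun j _ =>
      (((continuous_star.comp (hl i)).mul continuous_const).mul continuous_const).mul (hl j)
  have hn : Continuous fun z : Ball => nsq z.1 := continuous_fun_nsq.comp continuous_subtype_val
  refine (measurableSet_le (continuous_const.mul ((hQ.norm).pow 2)).measurable ((continuous_const).mul ((continuous_const.sub hn).pow 2)).measurable).inter ?_
  exact (((hz0.add continuous_const).norm.measurable).div ((hz0.sub continuous_const).norm.measurable)) measurableSet_Icc

/-- **THE BALL PICTURE.**  Under a Sylvester transport `e` (§1), the orbit HS-ball cut by the slab, `{g ∣ Σ|(g⁻¹γg)_{ij}|² ≤ R, s(g) ∈ [1,2]}`, lies in the preimage under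
`g ↦ e(g) · 0` of `D_R = {z ∣ 4|Σ \overline{ẑ_i} J_{ii} (TγT)_{ij} ẑ_j|² ≤ (R+1)(1−|z|²)², |z₀+1|∕|z₀−1| ∈ [1,2]}` (★ (I1) `hs_inv_conj_le_iff`, ★ `mat_apply_two_eq_mul_lift`).
[cite: Rudin1980, §2.2 Thm. 2.2.2] [cite: BeuzartPlessis2020Asterisque, §1.2 p. 21] -/
theorem hsOrbitBall_inter_slab_subset_preimage {γ : ↥(unitaryGroupOfForm (starRingEnd ℂ) (Matrix.of fun i j : Fin 3 => if i.val + j.val + 1 = 3 then (1 : ℂ) else 0))} {α u : ℂ} (hγ : ((γ : GL (Fin 3) ℂ) : Matrix (Fin 3) (Fin 3) ℂ) = !![α, 0, 0; 0, u, 0; 0, 0, (star α)⁻¹])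
    (e : ↥(unitaryGroupOfForm (starRingEnd ℂ) (Matrix.of fun i j : Fin 3 => if i.val + j.val + 1 = 3 then (1 : ℂ) else 0)) ≃ₜ* ↥U21) (he : ∀ g : ↥(unitaryGroupOfForm (starRingEnd ℂ) (Matrix.of fun i j : Fin 3 => if i.val + j.val + 1 = 3 then (1 : ℂ) else 0)), mat (e g) = (!![((Real.sqrt 2)⁻¹ : ℂ), 0, ((Real.sqrt 2)⁻¹ : ℂ); 0, 1, 0; ((Real.sqrt 2)⁻¹ : ℂ), 0, -((Real.sqrt 2)⁻¹ : ℂ)] : Matrix (Fin 3) (Fin 3) ℂ) * ((g : GL (Fin 3) ℂ) : Matrix (Fin 3) (Fin 3) ℂ) * (!![((Real.sqrt 2)⁻¹ : ℂ), 0, ((Real.sqrt 2)⁻¹ : ℂ); 0, 1, 0; ((Real.sqrt 2)⁻¹ : ℂ), 0, -((Real.sqrt 2)⁻¹ : ℂ)] : Matrix (Fin 3) (Fin 3) ℂ))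
    (hhs : ∀ g x : ↥(unitaryGroupOfForm (starRingEnd ℂ) (Matrix.of fun i j : Fin 3 => if i.val + j.val + 1 = 3 then (1 : ℂ) else 0)), ∑ i : Fin 3, ∑ j : Fin 3, ‖mat ((e g)⁻¹ * e x * e g) i j‖ ^ 2 = ∑ i : Fin 3, ∑ j : Fin 3, ‖(((g⁻¹ * x * g : ↥(unitaryGroupOfForm (starRingEnd ℂ) (Matrix.of fun i j : Fin 3 => if i.val + j.val + 1 = 3 then (1 : ℂ) else 0))) : GL (Fin 3) ℂ) : Matrix (Fin 3) (Fin 3) ℂ) i j‖ ^ 2)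
    (hcol : ∀ g : ↥(unitaryGroupOfForm (starRingEnd ℂ) (Matrix.of fun i j : Fin 3 => if i.val + j.val + 1 = 3 then (1 : ℂ) else 0)), mat (e g) 0 2 + mat (e g) 2 2 = ((g : GL (Fin 3) ℂ) : Matrix (Fin 3) (Fin 3) ℂ) 0 0 - ((g : GL (Fin 3) ℂ) : Matrix (Fin 3) (Fin 3) ℂ) 0 2 ∧ mat (e g) 0 2 - mat (e g) 2 2 = ((g : GL (Fin 3) ℂ) : Matrix (Fin 3) (Fin 3) ℂ) 2 0 - ((g : GL (Fin 3) ℂ) : Matrix (Fin 3) (Fin 3) ℂ) 2 2)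
    (R : ℝ) :
    {g : ↥(unitaryGroupOfForm (starRingEnd ℂ) (Matrix.of fun i j : Fin 3 => if i.val + j.val + 1 = 3 then (1 : ℂ) else 0)) | ∑ i : Fin 3, ∑ j : Fin 3, ‖(((g⁻¹ * γ * g) : GL (Fin 3) ℂ) : Matrix (Fin 3) (Fin 3) ℂ) i j‖ ^ 2 ≤ R} ∩ {g : ↥(unitaryGroupOfForm (starRingEnd ℂ) (Matrix.of fun i j : Fin 3 => if i.val + j.val + 1 = 3 then (1 : ℂ) else 0)) | (fun g : ↥(unitaryGroupOfForm (starRingEnd ℂ) (Matrix.of fun i j : Fin 3 => if i.val + j.val + 1 = 3 then (1 : ℂ) else 0)) => ‖((g : GL (Fin 3) ℂ) : Matrix (Fin 3) (Fin 3) ℂ) 0 0 - ((g : GL (Fin 3) ℂ) : Matrix (Fin 3) (Fin 3) ℂ) 0 2‖ / ‖((g : GL (Fin 3) ℂ) : Matrix (Fin 3) (Fin 3) ℂ) 2 0 - ((g : GL (Fin 3) ℂ) : Matrix (Fin 3) (Fin 3) ℂ) 2 2‖) g ∈ Icc (1 : ℝ) 2} ⊆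
      e ⁻¹' ((fun h : ↥U21 => h • x₀) ⁻¹' {z : Ball | 4 * ‖∑ i : Fin 3, ∑ j : Fin 3, star (lift z i) * J i i * (!![(α + (star α)⁻¹) / 2, 0, (α - (star α)⁻¹) / 2; 0, u, 0; (α - (star α)⁻¹) / 2, 0, (α + (star α)⁻¹) / 2] : Matrix (Fin 3) (Fin 3) ℂ) i j * lift z j‖ ^ 2 ≤ (R + 1) * (1 - nsq z.1) ^ 2 ∧ ‖z.1 0 + 1‖ / ‖z.1 0 - 1‖ ∈ Icc (1 : ℝ) 2}) := by
  intro g hg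
  obtain ⟨hball, hslab⟩ := hg
  simp only [Set.mem_setOf_eq] at hball hslab
  have hγJ : mat (e γ) = (!![(α + (star α)⁻¹) / 2, 0, (α - (star α)⁻¹) / 2; 0, u, 0; (α - (star α)⁻¹) / 2, 0, (α + (star α)⁻¹) / 2] : Matrix (Fin 3) (Fin 3) ℂ) := by rw [he, hγ, sylv_conj_diagonal]
  refine ⟨?_, ?_⟩
  · -- the ball condition through (I1)
    have h1 := (hs_inv_conj_le_iff (e g) (e γ) R).1 (by rw [hhs]; exact hball)
    rw [hγJ] at h1
    exact h1
  · -- the slab through the last column of `e g`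
    obtain ⟨hc1, hc2⟩ := hcol g
    have h22 : mat (e g) 2 2 ≠ 0 := norm_pos_iff.1 (norm_22_pos (e g))
    have hp : mat (e g) 0 2 + mat (e g) 2 2 = mat (e g) 2 2 * ((e g • x₀).1 0 + 1) := by
      rw [mat_apply_two_eq_mul_lift (e g) 0, lift_0]; ring
    have hm : mat (e g) 0 2 - mat (e g) 2 2 = mat (e g) 2 2 * ((e g • x₀).1 0 - 1) := by
      rw [mat_apply_two_eq_mul_lift (e g) 0, lift_0]; ring
    have hratio : ‖(e g • x₀).1 0 + 1‖ / ‖(e g • x₀).1 0 - 1‖ = ‖((g : GL (Fin 3) ℂ) : Matrix (Fin 3) (Fin 3) ℂ) 0 0 - ((g : GL (Fin 3) ℂ) : Matrix (Fin 3) (Fin 3) ℂ) 0 2‖ / ‖((g : GL (Fin 3) ℂ) : Matrix (Fin 3) (Fin 3) ℂ) 2 0 - ((g : GL (Fin 3) ℂ) : Matrix (Fin 3) (Fin 3) ℂ) 2 2‖ := by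
      rw [← hc1, ← hc2, hp, hm, norm_mul, norm_mul, mul_div_mul_left _ _ (norm_ne_zero_iff.2 h22)]
    show ‖(e g • x₀).1 0 + 1‖ / ‖(e g • x₀).1 0 - 1‖ ∈ Icc (1 : ℝ) 2
    rw [hratio]
    exact hslab

/-- **HAAR MASS OF THE ORBIT BALL ∩ SLAB ≤ c · 9 · vol(B₁) · K² · (R+1)** — for every Haar measure `ν` on `U(Φ₃)(ℂ)`: transport by `e` (Haar ↦ Haar), orbit map (★
`map_orbit_haar_eq_smul_bergmanVolume`: `(· • 0)_* = c · β`), chart (★ `bergmanVolume_eq_smul_map_chart`: `β = 9 · chart_* vol`), and the box (§3).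
[cite: Rudin1980, §2.2 Thm. 2.2.6] [cite: Helgason2000, Ch. I §1 No. 2, Thm. 1.9] [cite: BeuzartPlessis2020Asterisque, §1.2 (1.2.2), (1.2.4) p. 21] -/
theorem haar_hsOrbitBall_inter_slab_le {γ : ↥(unitaryGroupOfForm (starRingEnd ℂ) (Matrix.of fun i j : Fin 3 => if i.val + j.val + 1 = 3 then (1 : ℂ) else 0))} {α u : ℂ} (hγ : ((γ : GL (Fin 3) ℂ) : Matrix (Fin 3) (Fin 3) ℂ) = !![α, 0, 0; 0, u, 0; 0, 0, (star α)⁻¹]) (hu : ‖u‖ = 1) (hα : α ≠ 0) (hα1 : ‖α‖ ≠ 1)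
    [MeasurableSpace ↥(unitaryGroupOfForm (starRingEnd ℂ) (Matrix.of fun i j : Fin 3 => if i.val + j.val + 1 = 3 then (1 : ℂ) else 0))] [BorelSpace ↥(unitaryGroupOfForm (starRingEnd ℂ) (Matrix.of fun i j : Fin 3 => if i.val + j.val + 1 = 3 then (1 : ℂ) else 0))] (ν : Measure ↥(unitaryGroupOfForm (starRingEnd ℂ) (Matrix.of fun i j : Fin 3 => if i.val + j.val + 1 = 3 then (1 : ℂ) else 0))) [ν.IsHaarMeasure] :
    ∃ c : ℝ≥0∞, c ≠ ⊤ ∧ ∀ R : ℝ, 0 ≤ R →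
      ν ({g : ↥(unitaryGroupOfForm (starRingEnd ℂ) (Matrix.of fun i j : Fin 3 => if i.val + j.val + 1 = 3 then (1 : ℂ) else 0)) | ∑ i : Fin 3, ∑ j : Fin 3, ‖(((g⁻¹ * γ * g) : GL (Fin 3) ℂ) : Matrix (Fin 3) (Fin 3) ℂ) i j‖ ^ 2 ≤ R} ∩ {g : ↥(unitaryGroupOfForm (starRingEnd ℂ) (Matrix.of fun i j : Fin 3 => if i.val + j.val + 1 = 3 then (1 : ℂ) else 0)) | (fun g : ↥(unitaryGroupOfForm (starRingEnd ℂ) (Matrix.of fun i j : Fin 3 => if i.val + j.val + 1 = 3 then (1 : ℂ) else 0)) => ‖((g : GL (Fin 3) ℂ) : Matrix (Fin 3) (Fin 3) ℂ) 0 0 - ((g : GL (Fin 3) ℂ) : Matrix (Fin 3) (Fin 3) ℂ) 0 2‖ / ‖((g : GL (Fin 3) ℂ) : Matrix (Fin 3) (Fin 3) ℂ) 2 0 - ((g : GL (Fin 3) ℂ) : Matrix (Fin 3) (Fin 3) ℂ) 2 2‖) g ∈ Icc (1 : ℝ) 2}) ≤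
        c * ENNReal.ofReal (((3 / 4 + 91 / 16 * (‖α‖ * (1 / 2 + ‖α‖ / (‖α‖ - 1) ^ 2) / |‖α‖ ^ 2 - 1|) + 7 / 4 * (‖α‖ / (‖α‖ - 1) ^ 2)) * Real.sqrt (R + 1)) ^ 2) := by
  obtain ⟨e, he, hhs, hcol⟩ := exists_sylvester_continuousMulEquiv_U21
  haveI : (ν.map e).IsHaarMeasure := e.isHaarMeasure_map ν
  have hme : MeasurableEmbedding e := e.toHomeomorph.measurableEmbedding
  obtain ⟨c, -, hct, hc⟩ := map_orbit_haar_eq_smul_bergmanVolume (ν.map e)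
  have hV : volume (Metric.ball (0 : Fin 2 → ℂ) 1) ≠ ⊤ := measure_ball_lt_top.ne
  refine ⟨c * (9 * volume (Metric.ball (0 : Fin 2 → ℂ) 1)), ENNReal.mul_ne_top hct (ENNReal.mul_ne_top ENNReal.ofNat_ne_top hV), fun R hR => ?_⟩
  have horb : Continuous fun h : ↥U21 => h • x₀ := continuous_id.smul continuous_const
  have hcm : Measurable fun W : Fin 2 → ℂ => (proj ![W 0, W 1, (Real.sqrt (1 + nsq W) : ℂ)] (Q_vecCons_sqrt_one_add_nsq_neg W)) := continuous_chart.measurable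
  have hDm := measurableSet_D α u R
  calc ν ({g : ↥(unitaryGroupOfForm (starRingEnd ℂ) (Matrix.of fun i j : Fin 3 => if i.val + j.val + 1 = 3 then (1 : ℂ) else 0)) | ∑ i : Fin 3, ∑ j : Fin 3, ‖(((g⁻¹ * γ * g) : GL (Fin 3) ℂ) : Matrix (Fin 3) (Fin 3) ℂ) i j‖ ^ 2 ≤ R} ∩ {g : ↥(unitaryGroupOfForm (starRingEnd ℂ) (Matrix.of fun i j : Fin 3 => if i.val + j.val + 1 = 3 then (1 : ℂ) else 0)) | (fun g : ↥(unitaryGroupOfForm (starRingEnd ℂ) (Matrix.of fun i j : Fin 3 => if i.val + j.val + 1 = 3 then (1 : ℂ) else 0)) => ‖((g : GL (Fin 3) ℂ) : Matrix (Fin 3) (Fin 3) ℂ) 0 0 - ((g : GL (Fin 3) ℂ) : Matrix (Fin 3) (Fin 3) ℂ) 0 2‖ / ‖((g : GL (Fin 3) ℂ) : Matrix (Fin 3) (Fin 3) ℂ) 2 0 - ((g : GL (Fin 3) ℂ) : Matrix (Fin 3) (Fin 3) ℂ) 2 2‖) g ∈ Icc (1 : ℝ) 2})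
      ≤ ν (e ⁻¹' ((fun h : ↥U21 => h • x₀) ⁻¹' {z : Ball | 4 * ‖∑ i : Fin 3, ∑ j : Fin 3, star (lift z i) * J i i * (!![(α + (star α)⁻¹) / 2, 0, (α - (star α)⁻¹) / 2; 0, u, 0; (α - (star α)⁻¹) / 2, 0, (α + (star α)⁻¹) / 2] : Matrix (Fin 3) (Fin 3) ℂ) i j * lift z j‖ ^ 2 ≤ (R + 1) * (1 - nsq z.1) ^ 2 ∧ ‖z.1 0 + 1‖ / ‖z.1 0 - 1‖ ∈ Icc (1 : ℝ) 2})) := measure_mono (hsOrbitBall_inter_slab_subset_preimage hγ e he hhs hcol R)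
    _ = (ν.map e) ((fun h : ↥U21 => h • x₀) ⁻¹' {z : Ball | 4 * ‖∑ i : Fin 3, ∑ j : Fin 3, star (lift z i) * J i i * (!![(α + (star α)⁻¹) / 2, 0, (α - (star α)⁻¹) / 2; 0, u, 0; (α - (star α)⁻¹) / 2, 0, (α + (star α)⁻¹) / 2] : Matrix (Fin 3) (Fin 3) ℂ) i j * lift z j‖ ^ 2 ≤ (R + 1) * (1 - nsq z.1) ^ 2 ∧ ‖z.1 0 + 1‖ / ‖z.1 0 - 1‖ ∈ Icc (1 : ℝ) 2}) := by rw [hme.map_apply]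
    _ ≤ ((ν.map e).map (fun h : ↥U21 => h • x₀)) {z : Ball | 4 * ‖∑ i : Fin 3, ∑ j : Fin 3, star (lift z i) * J i i * (!![(α + (star α)⁻¹) / 2, 0, (α - (star α)⁻¹) / 2; 0, u, 0; (α - (star α)⁻¹) / 2, 0, (α + (star α)⁻¹) / 2] : Matrix (Fin 3) (Fin 3) ℂ) i j * lift z j‖ ^ 2 ≤ (R + 1) * (1 - nsq z.1) ^ 2 ∧ ‖z.1 0 + 1‖ / ‖z.1 0 - 1‖ ∈ Icc (1 : ℝ) 2} := le_map_apply horb.measurable.aemeasurable _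
    _ = c * bergmanVolume {z : Ball | 4 * ‖∑ i : Fin 3, ∑ j : Fin 3, star (lift z i) * J i i * (!![(α + (star α)⁻¹) / 2, 0, (α - (star α)⁻¹) / 2; 0, u, 0; (α - (star α)⁻¹) / 2, 0, (α + (star α)⁻¹) / 2] : Matrix (Fin 3) (Fin 3) ℂ) i j * lift z j‖ ^ 2 ≤ (R + 1) * (1 - nsq z.1) ^ 2 ∧ ‖z.1 0 + 1‖ / ‖z.1 0 - 1‖ ∈ Icc (1 : ℝ) 2} := by rw [hc, Measure.smul_apply, smul_eq_mul]
    _ = c * (9 * volume ((fun W : Fin 2 → ℂ => (proj ![W 0, W 1, (Real.sqrt (1 + nsq W) : ℂ)] (Q_vecCons_sqrt_one_add_nsq_neg W))) ⁻¹' {z : Ball | 4 * ‖∑ i : Fin 3, ∑ j : Fin 3, star (lift z i) * J i i * (!![(α + (star α)⁻¹) / 2, 0, (α - (star α)⁻¹) / 2; 0, u, 0; (α - (star α)⁻¹) / 2, 0, (α + (star α)⁻¹) / 2] : Matrix (Fin 3) (Fin 3) ℂ) i j * lift z j‖ ^ 2 ≤ (R + 1) * (1 - nsq z.1) ^ 2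 ∧ ‖z.1 0 + 1‖ / ‖z.1 0 - 1‖ ∈ Icc (1 : ℝ) 2})) := by
        rw [bergmanVolume_eq_smul_map_chart, Measure.smul_apply, smul_eq_mul, Measure.map_apply hcm hDm]
    _ ≤ c * (9 * volume {W : Fin 2 → ℂ | nsq W ≤ (3 / 4 + 91 / 16 * (‖α‖ * (1 / 2 + ‖α‖ / (‖α‖ - 1) ^ 2) / |‖α‖ ^ 2 - 1|) + 7 / 4 * (‖α‖ / (‖α‖ - 1) ^ 2)) * Real.sqrt (R + 1)}) := by
        gcongr
        intro W hW
        exact nsq_le_of_chart_mem_hsOrbitBall_slab hu hα hα1 hR hW.1 hW.2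
    _ ≤ c * (9 * (ENNReal.ofReal (((3 / 4 + 91 / 16 * (‖α‖ * (1 / 2 + ‖α‖ / (‖α‖ - 1) ^ 2) / |‖α‖ ^ 2 - 1|) + 7 / 4 * (‖α‖ / (‖α‖ - 1) ^ 2)) * Real.sqrt (R + 1)) ^ 2) * volume (Metric.ball (0 : Fin 2 → ℂ) 1))) := by
        gcongr
        refine volume_setOf_nsq_le_le' ?_
        have h1 : 0 ≤ ‖α‖ * (1 / 2 + ‖α‖ / (‖α‖ - 1) ^ 2) / |‖α‖ ^ 2 - 1| := by positivity
        have h2 : 0 ≤ ‖α‖ / (‖α‖ - 1) ^ 2 := by positivity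
        positivity
    _ = c * (9 * volume (Metric.ball (0 : Fin 2 → ℂ) 1)) * ENNReal.ofReal (((3 / 4 + 91 / 16 * (‖α‖ * (1 / 2 + ‖α‖ / (‖α‖ - 1) ^ 2) / |‖α‖ ^ 2 - 1|) + 7 / 4 * (‖α‖ / (‖α‖ - 1) ^ 2)) * Real.sqrt (R + 1)) ^ 2) := by ring

end BallPicture

/-! ## §5 Assembly: LINEAR growth of the quotient volume of orbit HS-balls at a regular hyperbolic class -/

section Assembly

variable [MeasurableSpace ↥(unitaryGroupOfForm (starRingEnd ℂ) (Matrix.of fun i j : Fin 3 => if i.val + j.val + 1 = 3 then (1 : ℂ) else 0))] [BorelSpace ↥(unitaryGroupOfForm (starRingEnd ℂ) (Matrix.of fun i j : Fin 3 => if i.val + j.val + 1 = 3 then (1 : ℂ) else 0))] [LocallyCompactSpace ↥(unitaryGroupOfForm (starRingEnd ℂ) (Matrix.of fun i j : Fin 3 => if i.val + j.val + 1 = 3 then (1 : ℂ) else 0))] [SecondCountableTopology ↥(unitaryGroupOfForm (starRingEnd ℂ) (Matrix.of fun i j : Fin 3 => if i.val + j.val + 1 = 3 then (1 : ℂ) else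 0))]

/-- **HARISH-CHANDRA ORBIT GROWTH AT THE REGULAR HYPERBOLIC CLASSES OF `U(2,1)`, `e = 1` — brick (H′-ball).**  `G = U(Φ₃)(ℂ)`, `γ ∈ G` of matrix
`diag(α, u, ᾱ⁻¹)`, `|u| = 1`, `|α| ≠ 1` (regular hyperbolic normal form, ★ `exists_conj_eq_diagonal_of_separable_of_exists_norm_root_ne_one`), `ν` Haar on `G` (right- and
inversion-invariant), `ρ` Haar and inversion-invariant on the centraliser `Z(γ)`; then for the Weil quotient `μ = quotientMeasure Z(γ) ρ ν` on `G ⧸ Z(γ)`: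
  **`∃ C, ∀ R ≥ 1, μ {x Z(γ) ∣ Σ_{ij} |(x γ x⁻¹)_{ij}|² ≤ R} ≤ C · R`.**
(★ SLAB-DESCENT `quotientMeasure_setOf_descConj_le_le_inv_mul_measure` with `T := Z(γ)`, `χ(t) = |t₀₀|²` (★ `chi_mul`∕`chi_pos`∕`continuous_chi`∕`chi_onto`), `κ ≠ ⊤` by ★
`measure_setOf_centralizer_normSq_mem_Icc_ne_top`, slab `s(g) = |g₀₀−g₀₂|∕|g₂₀−g₂₂|` (§2), `l = 2`; then §4 and `(R+1) ≤ 2R`.)  INFINITE-MEASURE CAVEAT: the Haar measure of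
`{g ∣ Σ|(g⁻¹γg)_{ij}|² ≤ R}` is `∞`; only its SLAB-cut, equivalently the quotient measure, grows like `R`.  This is the `hplace` token (a = 1) of ★
`integrable_orbitalIntegrand_of_archSchwartzOn_antidiagOne_of_placewise_growth` at a hyperbolic place.
[cite: BeuzartPlessis2020Asterisque, §1.2 (1.2.2), (1.2.4) p. 21; §1.8 p. 39] [cite: HarishChandra1966, §9] [cite: Rudin1980, §2.2 Thm. 2.2.6] [cite: Folland1995, §2.6 Thm. 2.49] -/
theorem quotientMeasure_hsOrbitBall_le_linear_of_diag_hyperbolic {γ : ↥(unitaryGroupOfForm (starRingEnd ℂ) (Matrix.of fun i j : Fin 3 => if i.val + j.val + 1 = 3 then (1 : ℂ) else 0))} {α u : ℂ}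
    (hγ : ((γ : GL (Fin 3) ℂ) : Matrix (Fin 3) (Fin 3) ℂ) = !![α, 0, 0; 0, u, 0; 0, 0, (star α)⁻¹]) (hu : ‖u‖ = 1) (hα1 : ‖α‖ ≠ 1)
    (ν : Measure ↥(unitaryGroupOfForm (starRingEnd ℂ) (Matrix.of fun i j : Fin 3 => if i.val + j.val + 1 = 3 then (1 : ℂ) else 0))) [ν.IsHaarMeasure] [ν.IsMulRightInvariant] [ν.IsInvInvariant]
    (ρ : Measure ↥(Subgroup.centralizer ({γ} : Set ↥(unitaryGroupOfForm (starRingEnd ℂ) (Matrix.of fun i j : Fin 3 => if i.val + j.val + 1 = 3 then (1 : ℂ) else 0))))) [ρ.IsHaarMeasure] [ρ.IsInvInvariant]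
    [MeasurableSpace (↥(unitaryGroupOfForm (starRingEnd ℂ) (Matrix.of fun i j : Fin 3 => if i.val + j.val + 1 = 3 then (1 : ℂ) else 0)) ⧸ Subgroup.centralizer ({γ} : Set ↥(unitaryGroupOfForm (starRingEnd ℂ) (Matrix.of fun i j : Fin 3 => if i.val + j.val + 1 = 3 then (1 : ℂ) else 0))))] [BorelSpace (↥(unitaryGroupOfForm (starRingEnd ℂ) (Matrix.of fun i j : Fin 3 => if i.val + j.val + 1 = 3 then (1 : ℂ) else 0)) ⧸ Subgroup.centralizer ({γ} : Set ↥(unitaryGroupOfForm (starRingEnd ℂ) (Matrix.of fun i j : Fin 3 => if i.val + j.val + 1 = 3 then (1 : ℂ) else 0))))] :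
    ∃ C : ℝ, ∀ R : ℝ, 1 ≤ R →
      quotientMeasure (Subgroup.centralizer ({γ} : Set ↥(unitaryGroupOfForm (starRingEnd ℂ) (Matrix.of fun i j : Fin 3 => if i.val + j.val + 1 = 3 then (1 : ℂ) else 0)))) ρ (isClosed_coe_centralizer_singleton γ) ν
          {x | descConj γ (Subgroup.centralizer ({γ} : Set ↥(unitaryGroupOfForm (starRingEnd ℂ) (Matrix.of fun i j : Fin 3 => if i.val + j.val + 1 = 3 then (1 : ℂ) else 0)))) (fun _ h => Subgroup.mem_centralizer_singleton_iff.1 h)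
            (fun g : ↥(unitaryGroupOfForm (starRingEnd ℂ) (Matrix.of fun i j : Fin 3 => if i.val + j.val + 1 = 3 then (1 : ℂ) else 0)) => ∑ i : Fin 3, ∑ j : Fin 3, ‖((g : GL (Fin 3) ℂ) : Matrix (Fin 3) (Fin 3) ℂ) i j‖ ^ 2) x ≤ R} ≤ ENNReal.ofReal (C * R) := by
  classical
  -- `α ≠ 0` (γ is invertible) and the three eigenvalues are pairwise distinct
  have hα : α ≠ 0 := by
    intro h0
    have hdet : (((γ : GL (Fin 3) ℂ) : Matrix (Fin 3) (Fin 3) ℂ)).det ≠ 0 := by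
      rw [← Matrix.GeneralLinearGroup.val_det_apply]; exact Units.ne_zero _
    rw [hγ, h0, Matrix.det_fin_three] at hdet
    simp at hdet
  have hβn : ‖(star α)⁻¹‖ = ‖α‖⁻¹ := by rw [norm_inv, norm_star]
  have hαu : α ≠ u := fun h => hα1 (by rw [h, hu])
  have huβ : u ≠ (star α)⁻¹ := by
    intro h
    have h1 : ‖α‖⁻¹ = 1 := by rw [← hβn, ← h, hu]
    exact hα1 (inv_eq_one.1 h1)
  have hαβ : α ≠ (star α)⁻¹ := by
    intro h
    have h1 : ‖α‖ = ‖α‖⁻¹ := by rw [← hβn, ← h]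
    have hpos : 0 < ‖α‖ := norm_pos_iff.2 hα
    have h2 : ‖α‖ * ‖α‖ = 1 := by
      have := congrArg (· * ‖α‖) h1
      simp only [inv_mul_cancel₀ hpos.ne'] at this
      exact this
    exact hα1 (by nlinarith [hpos])
  -- the torus tokens
  haveI hZ : IsClosed ((Subgroup.centralizer ({γ} : Set ↥(unitaryGroupOfForm (starRingEnd ℂ) (Matrix.of fun i j : Fin 3 => if i.val + j.val + 1 = 3 then (1 : ℂ) else 0))) : Subgroup ↥(unitaryGroupOfForm (starRingEnd ℂ) (Matrix.of fun i j : Fin 3 => if i.val + j.val + 1 = 3 then (1 : ℂ) else 0))) : Set ↥(unitaryGroupOfForm (starRingEnd ℂ) (Matrix.of fun i j : Fin 3 => if i.val + j.val + 1 = 3 then (1 : ℂ) else 0))) := isClosed_coe_centralizer_singleton γ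
  have hκ : ρ {t : ↥(Subgroup.centralizer ({γ} : Set ↥(unitaryGroupOfForm (starRingEnd ℂ) (Matrix.of fun i j : Fin 3 => if i.val + j.val + 1 = 3 then (1 : ℂ) else 0)))) | ‖((((t : ↥(Subgroup.centralizer ({γ} : Set ↥(unitaryGroupOfForm (starRingEnd ℂ) (Matrix.of fun i j : Fin 3 => if i.val + j.val + 1 = 3 then (1 : ℂ) else 0))))) : ↥(unitaryGroupOfForm (starRingEnd ℂ) (Matrix.of fun i j : Fin 3 => if i.val + j.val + 1 = 3 then (1 : ℂ) else 0))) : GL (Fin 3) ℂ) : Matrix (Fin 3) (Fin 3) ℂ) 0 0‖ ^ 2 ∈ Icc (1 : ℝ) 2} ≠ ⊤ :=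
    measure_setOf_centralizer_normSq_mem_Icc_ne_top (Γ := unitaryGroupOfForm (starRingEnd ℂ) (Matrix.of fun i j : Fin 3 => if i.val + j.val + 1 = 3 then (1 : ℂ) else 0)) le_rfl hγ hu hα hα1
      isClosed_unitaryGroupOfForm_antidiag_three ρ 2
  have hκ0 : ρ {t : ↥(Subgroup.centralizer ({γ} : Set ↥(unitaryGroupOfForm (starRingEnd ℂ) (Matrix.of fun i j : Fin 3 => if i.val + j.val + 1 = 3 then (1 : ℂ) else 0)))) | ‖((((t : ↥(Subgroup.centralizer ({γ} : Set ↥(unitaryGroupOfForm (starRingEnd ℂ) (Matrix.of fun i j : Fin 3 => if i.val + j.val + 1 = 3 then (1 : ℂ) else 0))))) : ↥(unitaryGroupOfForm (starRingEnd ℂ) (Matrix.of fun i j : Fin 3 => if i.val + j.val + 1 = 3 then (1 : ℂ) else 0))) : GL (Fin 3) ℂ) : Matrix (Fin 3) (Fin 3) ℂ) 0 0‖ ^ 2 ∈ Icc (1 : ℝ) 2} ≠ 0 :=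
    measure_setOf_chi_mem_Icc_ne_zero (Subgroup.centralizer ({γ} : Set ↥(unitaryGroupOfForm (starRingEnd ℂ) (Matrix.of fun i j : Fin 3 => if i.val + j.val + 1 = 3 then (1 : ℂ) else 0)))) (χ := fun t : ↥(Subgroup.centralizer ({γ} : Set ↥(unitaryGroupOfForm (starRingEnd ℂ) (Matrix.of fun i j : Fin 3 => if i.val + j.val + 1 = 3 then (1 : ℂ) else 0)))) => ‖((((t : ↥(Subgroup.centralizer ({γ} : Set ↥(unitaryGroupOfForm (starRingEnd ℂ) (Matrix.of fun i j : Fin 3 => if i.val + j.val + 1 = 3 then (1 : ℂ) else 0))))) : ↥(unitaryGroupOfForm (starRingEnd ℂ) (Matrix.of fun i j : Fin 3 => if i.val + j.val + 1 = 3 then (1 : ℂ) else 0))) : GL (Fin 3) ℂ) : Matrix (Fin 3) (Fin 3) ℂ) 0 0‖ ^ 2)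
      continuous_chi (chi_onto hγ) ρ one_lt_two
  -- the Haar mass of the slab-cut orbit ball (§4)
  obtain ⟨c, hct, hcR⟩ := haar_hsOrbitBall_inter_slab_le hγ hu hα hα1 ν
  set K : ℝ := (3 / 4 + 91 / 16 * (‖α‖ * (1 / 2 + ‖α‖ / (‖α‖ - 1) ^ 2) / |‖α‖ ^ 2 - 1|) + 7 / 4 * (‖α‖ / (‖α‖ - 1) ^ 2)) with hK
  set κ : ℝ≥0∞ := ρ {t : ↥(Subgroup.centralizer ({γ} : Set ↥(unitaryGroupOfForm (starRingEnd ℂ) (Matrix.of fun i j : Fin 3 => if i.val + j.val + 1 = 3 then (1 : ℂ) else 0)))) | ‖((((t : ↥(Subgroup.centralizer ({γ} : Set ↥(unitaryGroupOfForm (starRingEnd ℂ) (Matrix.of fun i j : Fin 3 => if i.val + j.val + 1 = 3 then (1 : ℂ) else 0))))) : ↥(unitaryGroupOfForm (starRingEnd ℂ) (Matrix.of fun i j : Fin 3 => if i.val + j.val + 1 = 3 then (1 : ℂ) else 0))) : GL (Fin 3) ℂ) : Matrix (Fin 3) (Fin 3) ℂ) 0 0‖ ^ 2 ∈ Icc (1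 : ℝ) 2} with hκdef
  have hκi : κ⁻¹ ≠ ⊤ := ENNReal.inv_ne_top.2 hκ0
  have hA : κ⁻¹ * c ≠ ⊤ := ENNReal.mul_ne_top hκi hct
  refine ⟨(κ⁻¹ * c).toReal * (2 * K ^ 2), fun R hR => ?_⟩
  have hR0 : 0 ≤ R := by linarith
  -- measurability of the HS radius along conjugates
  have hcont : Continuous fun g : ↥(unitaryGroupOfForm (starRingEnd ℂ) (Matrix.of fun i j : Fin 3 => if i.val + j.val + 1 = 3 then (1 : ℂ) else 0)) => ((g : GL (Fin 3) ℂ) : Matrix (Fin 3) (Fin 3) ℂ) := Units.continuous_val.comp continuous_subtype_val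
  have hF : Measurable fun g : ↥(unitaryGroupOfForm (starRingEnd ℂ) (Matrix.of fun i j : Fin 3 => if i.val + j.val + 1 = 3 then (1 : ℂ) else 0)) => ∑ i : Fin 3, ∑ j : Fin 3, ‖(((g * γ * g⁻¹) : GL (Fin 3) ℂ) : Matrix (Fin 3) (Fin 3) ℂ) i j‖ ^ 2 := by
    have hc : Continuous fun g : ↥(unitaryGroupOfForm (starRingEnd ℂ) (Matrix.of fun i j : Fin 3 => if i.val + j.val + 1 = 3 then (1 : ℂ) else 0)) => (((g * γ * g⁻¹ : ↥(unitaryGroupOfForm (starRingEnd ℂ) (Matrix.of fun i j : Fin 3 => if i.val + j.val + 1 = 3 then (1 : ℂ) else 0))) : GL (Fin 3) ℂ) : Matrix (Fin 3) (Fin 3) ℂ) := hcont.comp ((continuous_id.mul continuous_const).mul continuous_inv)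
    exact (continuous_finsetSum _ fun i _ => continuous_finsetSum _ fun j _ => ((hc.matrix_elem i j).norm).pow 2).measurable
  -- SLAB-DESCENT
  have hSD := quotientMeasure_setOf_descConj_le_le_inv_mul_measure (Subgroup.centralizer ({γ} : Set ↥(unitaryGroupOfForm (starRingEnd ℂ) (Matrix.of fun i j : Fin 3 => if i.val + j.val + 1 = 3 then (1 : ℂ) else 0)))) γ
    (fun _ h => Subgroup.mem_centralizer_singleton_iff.1 h)
    (χ := fun t : ↥(Subgroup.centralizer ({γ} : Set ↥(unitaryGroupOfForm (starRingEnd ℂ) (Matrix.of fun i j : Fin 3 => if i.val + j.val + 1 = 3 then (1 : ℂ) else 0)))) => ‖((((t : ↥(Subgroup.centralizer ({γ} : Set ↥(unitaryGroupOfForm (starRingEnd ℂ) (Matrix.of fun i j : Fin 3 => if i.val + j.val + 1 = 3 then (1 : ℂ) else 0))))) : ↥(unitaryGroupOfForm (starRingEnd ℂ) (Matrix.of fun i j : Fin 3 => if i.val + j.val + 1 = 3 then (1 : ℂ) else 0))) : GL (Fin 3) ℂ) : Matrix (Fin 3) (Fin 3) ℂ) 0 0‖ ^ 2) (chi_mul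 hγ hu hα1) (chi_pos hγ hu hα1) continuous_chi (chi_onto hγ) ρ ν
    (F := fun g : ↥(unitaryGroupOfForm (starRingEnd ℂ) (Matrix.of fun i j : Fin 3 => if i.val + j.val + 1 = 3 then (1 : ℂ) else 0)) => ∑ i : Fin 3, ∑ j : Fin 3, ‖((g : GL (Fin 3) ℂ) : Matrix (Fin 3) (Fin 3) ℂ) i j‖ ^ 2) hF
    (s := fun g : ↥(unitaryGroupOfForm (starRingEnd ℂ) (Matrix.of fun i j : Fin 3 => if i.val + j.val + 1 = 3 then (1 : ℂ) else 0)) => ‖((g : GL (Fin 3) ℂ) : Matrix (Fin 3) (Fin 3) ℂ) 0 0 - ((g : GL (Fin 3) ℂ) : Matrix (Fin 3) (Fin 3) ℂ) 0 2‖ / ‖((g : GL (Fin 3) ℂ) : Matrix (Fin 3) (Fin 3) ℂ) 2 0 - ((g : GL (Fin 3) ℂ) : Matrix (Fin 3) (Fin 3) ℂ) 2 2‖) slabFun_measurable slabFun_pos (slabFun_centralizer_mul hγ hαu huβ hαβ) one_lt_two hκ R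
  refine hSD.trans ?_
  calc κ⁻¹ * ν ({g : ↥(unitaryGroupOfForm (starRingEnd ℂ) (Matrix.of fun i j : Fin 3 => if i.val + j.val + 1 = 3 then (1 : ℂ) else 0)) | ∑ i : Fin 3, ∑ j : Fin 3, ‖(((g⁻¹ * γ * g) : GL (Fin 3) ℂ) : Matrix (Fin 3) (Fin 3) ℂ) i j‖ ^ 2 ≤ R} ∩ {g : ↥(unitaryGroupOfForm (starRingEnd ℂ) (Matrix.of fun i j : Fin 3 => if i.val + j.val + 1 = 3 then (1 : ℂ) else 0)) | (fun g : ↥(unitaryGroupOfForm (starRingEnd ℂ) (Matrix.of fun i j : Fin 3 => if i.val + j.val + 1 = 3 then (1 : ℂ) else 0)) => ‖((g : GL (Fin 3) ℂ) : Matrix (Fin 3) (Fin 3) ℂ) 0 0 - ((g : GL (Fin 3) ℂ) : Matrix (Fin 3) (Fin 3) ℂ) 0 2‖ / ‖((g : GL (Fin 3) ℂ) : Matrix (Fin 3) (Fin 3) ℂ) 2 0 - ((g : GL (Fin 3) ℂ) : Matrix (Fin 3) (Fin 3) ℂ) 2 2‖) g ∈ Icc (1 : ℝ) 2})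
      ≤ κ⁻¹ * (c * ENNReal.ofReal ((K * Real.sqrt (R + 1)) ^ 2)) := by gcongr; exact hcR R hR0
    _ = (κ⁻¹ * c) * ENNReal.ofReal ((K * Real.sqrt (R + 1)) ^ 2) := by ring
    _ ≤ (κ⁻¹ * c) * ENNReal.ofReal (2 * K ^ 2 * R) := by
        gcongr
        rw [mul_pow, Real.sq_sqrt (by linarith)]
        nlinarith [sq_nonneg K]
    _ = ENNReal.ofReal ((κ⁻¹ * c).toReal * (2 * K ^ 2) * R) := by
        rw [mul_assoc ((κ⁻¹ * c).toReal), ENNReal.ofReal_mul ENNReal.toReal_nonneg, ENNReal.ofReal_toReal hA]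

end Assembly

end Literature.NumberTheory.Rogawski1990

end
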